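import Literature.NumberTheory.GaloisRepresentations.LAdicCharacterAnalyticExpansionProofs
import Literature.NumberTheory.GaloisRepresentations.PowLocallyAlgebraicQuadraticProofs
import Literature.NumberTheory.GaloisRepresentations.LAdicCharacterIdelicValuesProofs
import Literature.NumberTheory.GaloisRepresentations.WeakAbelianDirectSummandOfThm22Proofs
import Literature.NumberTheory.Transcendental.RoyPadicRankThm1
import HarnessLib

/-!
# Böckle–Hui Theorem 2.2 for every number field, and the discharge of
# `exists_heckeCharacter_of_weaklyDivides`

Topic `NumberTheory/GaloisRepresentations`; namespace
`Literature.NumberTheory.GaloisRepresentations` (grouping sub-namespace `LogLinear`).  A *proofs*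
file: theorems only — no definition, no named fact, no instance.

## Main results

* `LogLinear.pow_isLocallyAlgebraic_of_frobenius_isAlgebraic` — the hypothesis `h22` of
  `exists_heckeCharacter_of_weaklyDivides_of_thm22` for EVERY number field `K`
  ([BockleHui2025, Thm 2.2]; Serre–Waldschmidt–Henniart): for a rank-one `ℓ`-adic character `ψ`
  of `Gal(K̄/K)` with idelic avatar `Ψ` whose Frobenius values are almost all algebraic, there are
  `N ≥ 1`, integers `n_τ` and a level `m` with `(∏_{v | ℓ} Ψ(⟨k⟩_v))^N = ∏_τ τ(k)^{−n_τ}` for all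
  `k ∈ Kˣ`, `k ≡ 1 [𝔭_v^m]` (`v | ℓ`), i.e. `ψ^N` is locally algebraic.
* `exists_heckeCharacter_of_weaklyDivides_holds : exists_heckeCharacter_of_weaklyDivides` — the
  named fact of `WeakAbelianDirectSummand.lean` ([BockleHui2025, Thm 1.1 with Cor. 2.10]) HOLDS.

## The proof of Theorem 2.2 (all `K`)

[BockleHui2025, §2.7 Step 1] invokes "a remarkable theorem of Waldschmidt on transcendental
numbers [Wa81]" ([Waldschmidt1981]; Henniart's deduction).  We follow the same architecture with
the transcendence input taken in the form the tree PROVES: M. Waldschmidt's linear subgroup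
theorem for `𝔾ₘ^{D}` over `ℂ_ℓ` in Roy's formulation ([Roy1992, §1 Theorem 1] =
[Waldschmidt1988, Thm 4.1], `RoyPadic.thm1_holds`, from Philippon's zero estimate).

1. *Log-linear relation* (`LogLinear.exists_logLinear`).  By the analytic expansion of
   `LAdicCharacterAnalyticExpansionProofs` (`Expansion.exists_expansion`: `f(k) = exp ∑ λ_τ L(τk)`
   on a congruence subgroup, `f = ∏_{v|ℓ} Ψ⟨·⟩_v`) and `log(exp c) = c`
   (`BrumerPadic.logSeries_exp`), `log_ℓ f(k) = ∑_τ λ_τ log_ℓ τ(k)` in `ℂ_ℓ` with Iwasawa's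
   logarithm `log_ℓ = padicLogAlgCl ℓ`; hence the vectors
   `P(k) = (log_ℓ τ(k))_τ ⊕ log_ℓ f(k) ∈ ℚ̄_ℓ^{d+1}` (`d = [K:ℚ]`) span a PROPER subspace `V`.
2. *Test elements* (`LogLinear.exists_test_family`): ray-class generators `πⱼ` of `𝔮ⱼ^H` for
   degree-one primes `𝔮ⱼ` of distinct norms `qⱼ ∉ 𝔮ⱼ²` outside the exceptional set, `πⱼ ≡ 1` deep
   at `ℓ`; their conjugates are multiplicatively independent
   (`LogLinear.eq_zero_of_prod_prod_zpow_eq_one`, by the rigidity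
   `NumberField.ringHom_eq_of_map_mem` of embeddings on a degree-one prime), and `f(πⱼ)` is
   algebraic (`IdelicCharacter.isAlgebraic_prod_map_localUnits`).
3. *Linear subgroup theorem* (`LogLinear.exists_intRow_of_thm1`, a wrapper of
   `RoyPadic.thm1_holds` with `d₀ = 0`, `W = 0`, `ω = 0`): finitely many vectors of Roy's
   `L^{D}` inside a proper `ℚ̄_ℓ`-subspace admit a non-zero INTEGER row `a` with
   `dim_ℚ ℚ·{∑ aᵢ P_{j,i}} ≤ D²`.  Applied to the `P(πⱼ)`: the character
   `β = f^{a₀} ∏ τ^{a_τ}` has `dim_ℚ ℚ·{log_ℓ β(πⱼ)} ≤ D²`; `a₀ ≠ 0` by independence.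
4. *Block kernels*: among any `D² + 1` test elements a non-trivial product `κ_t` lies in `ker β`
   (`LogLinear.exists_int_relation`, injectivity of `log_ℓ` near `1`); a second application of
   the linear subgroup theorem in dimension `d` and the independence show that the
   conjugate-logarithm vectors of `d² + 1` such `κ_t` span `ℚ̄_ℓ^d`.  Hence `V` is the rational
   hyperplane `∑ aᵢ yᵢ = 0`, i.e. `β ≡ 1` on the congruence subgroup: Theorem 2.2 with
   `N = |a₀|`.

The cases `K = ℚ`, `K` quadratic and `K` multiquadratic were proved earlier by the six
exponentials method (`PowLocallyAlgebraicRatProofs`, `…QuadraticProofs`, `…MultiQuadraticProofs`);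
the present file supersedes them.

## References

* [BockleHui2025] G. Böckle, C.-Y. Hui, *Weak abelian direct summands and irreducibility of
  Galois representations*, Math. Ann. (2025), doi:10.1007/s00208-025-03252-0: Thm 1.1, Thm 2.2,
  §2.3, §2.7 (Step 1), Cor. 2.10.
* [SerreAbelianLadic1968] J.-P. Serre, *Abelian ℓ-adic representations and elliptic curves*,
  Ch. III §1.1 (locally algebraic representations), §3.
* [Waldschmidt1981] M. Waldschmidt, *Transcendance et exponentielles en plusieurs variables*,
  Invent. Math. 63 (1981) — the transcendence theorem cited as [Wa81] by Böckle–Hui.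
* [Waldschmidt1988] M. Waldschmidt, *On the transcendence methods of Gel'fond and Schneider in
  several variables*, New Advances in Transcendence Theory (1988), Thm 1.1 and Thm 4.1.
* [Roy1992] D. Roy, *Matrices whose coefficients are linear forms in logarithms*, J. Number
  Theory 41 (1992), §1 Theorem 1 (p. 25).
* [LangCyclotomic1990] S. Lang, *Cyclotomic Fields I and II*, Ch. 4, Appendix to §3 (Iwasawa's
  logarithm).
-/

noncomputable section

open scoped NumberField
open NumberField IsDedekindDomain IsDedekindDomain.HeightOneSpectrum Filter Topology Finset NormedSpace Field
open Literature.NumberTheory.Transcendental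

/-! ### Part α. The log-linear relation -/

namespace Literature.NumberTheory.GaloisRepresentations

namespace LogLinear

variable {K : Type} [Field K] [NumberField K] {ℓ : ℕ} [Fact ℓ.Prime]

/-- **The log-linear relation.**  For a continuous `Ψ : 𝕀_K → ℚ̄_ℓˣ` and the set `L` of places
above `ℓ`, there are a depth `s ≥ 2` and coefficients `λ_τ ∈ ℂ_ℓ` (`τ` over the embeddings
`K → ℚ̄_ℓ`) such that for every `k ∈ Kˣ` with `k ≡ 1 [ℓ^s]` the value `f(k) = ∏_{v ∈ L} Ψ(⟨k⟩_v)`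
and all `τ(k)` are principal units of `ℚ̄_ℓ` and, with Iwasawa's `ℓ`-adic logarithm `log_ℓ`,
`log_ℓ f(k) = ∑_τ λ_τ log_ℓ τ(k)` in `ℂ_ℓ` (from `Expansion.exists_expansion` and
`log(exp c) = c`, `BrumerPadic.logSeries_exp`). [cite: SerreAbelianLadic1968, Ch. III §1.1]
[cite: BockleHui2025, §2.3] -/
theorem exists_logLinear (Ψ : ideleGroup K →ₜ* (PadicAlgCl ℓ)ˣ)
    (L : Finset (HeightOneSpectrum (𝓞 K))) (hL : ∀ v, v ∈ L → (ℓ : 𝓞 K) ∈ v.asIdeal) :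
    ∃ s : ℕ, 2 ≤ s ∧ ∃ lam : (K →+* PadicAlgCl ℓ) → ℂ_[ℓ],
      ∀ k : Kˣ, (∀ v : HeightOneSpectrum (𝓞 K), (ℓ : 𝓞 K) ∈ v.asIdeal →
          v.valuation K ((k : K) - 1) ≤ v.valuation K ((ℓ : K) ^ s)) →
        (∀ τ : K →+* PadicAlgCl ℓ, ‖1 - τ (k : K)‖ ≤ ((ℓ : ℝ)⁻¹) ^ s) ∧
        ‖1 - ∏ v ∈ L, ((Ψ (localUnits v (globalToLocalUnits v k)) : (PadicAlgCl ℓ)ˣ) :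
          PadicAlgCl ℓ)‖ < 4⁻¹ * (ℓ : ℝ)⁻¹ ∧
        ((padicLogAlgCl ℓ (∏ v ∈ L, ((Ψ (localUnits v (globalToLocalUnits v k)) :
          (PadicAlgCl ℓ)ˣ) : PadicAlgCl ℓ)) : PadicAlgCl ℓ) : ℂ_[ℓ]) =
          ∑ τ : K →+* PadicAlgCl ℓ, lam τ * ((padicLogAlgCl ℓ (τ (k : K)) : PadicAlgCl ℓ) : ℂ_[ℓ]) := by
  classical
  have hp : ℓ.Prime := Fact.out
  have hq0 : (0 : ℝ) < (ℓ : ℝ)⁻¹ := inv_pos.mpr (by exact_mod_cast hp.pos)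
  have hq1 : (ℓ : ℝ)⁻¹ < 1 := inv_lt_one_of_one_lt₀ (by exact_mod_cast hp.one_lt)
  set ιE : PadicAlgCl ℓ →+* ℂ_[ℓ] := algebraMap (PadicAlgCl ℓ) ℂ_[ℓ] with hιEdef
  have hιE : ∀ x, ιE x = (x : ℂ_[ℓ]) := fun x => (PadicComplex.coe_eq ℓ x).symm
  have hι : ∀ x, ‖ιE x‖ = ‖x‖ := fun x => by rw [hιE]; exact PadicComplex.norm_extends ℓ x
  have hε : (0 : ℝ) < 4⁻¹ * (ℓ : ℝ)⁻¹ := by positivity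
  have hεq : 4⁻¹ * (ℓ : ℝ)⁻¹ ≤ (ℓ : ℝ)⁻¹ := by
    have : (0 : ℝ) ≤ (ℓ : ℝ)⁻¹ := hq0.le
    nlinarith
  obtain ⟨s, hs2, lam, mu, hexp⟩ := Expansion.exists_expansion Ψ ιE hι L hL hε
  refine ⟨s, hs2, lam, fun k hk => ?_⟩
  obtain ⟨h1, hFn, hFe, -⟩ := hexp k hk
  have hqs1 : ((ℓ : ℝ)⁻¹) ^ s < 1 := pow_lt_one₀ hq0.le hq1 (by omega)
  -- the embeddings
  have hτ : ∀ τ : K →+* PadicAlgCl ℓ, ‖1 - τ (k : K)‖ ≤ ((ℓ : ℝ)⁻¹) ^ s := by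
    intro τ
    have := h1 τ
    rwa [← map_one ιE, ← map_sub, hι] at this
  -- the value `f(k)` is `exp` of a small element
  set z : ℂ_[ℓ] := ∑ τ, lam τ * ∑' m : ℕ, -((1 - ιE (τ (k : K))) ^ (m + 1)) / (m + 1 : ℂ_[ℓ]) with hz
  have hzε : ‖z‖ < 4⁻¹ * (ℓ : ℝ)⁻¹ := hFn
  have hzn : ‖z‖ < (ℓ : ℝ)⁻¹ := hzε.trans_le hεq
  have hf1 : ‖1 - ∏ v ∈ L, ((Ψ (localUnits v (globalToLocalUnits v k)) : (PadicAlgCl ℓ)ˣ) :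
      PadicAlgCl ℓ)‖ < 4⁻¹ * (ℓ : ℝ)⁻¹ := by
    rw [← hι, map_sub, map_one, hFe, norm_sub_rev]
    rw [PadicExp.norm_exp_sub_one hzn]
    exact hzε
  refine ⟨hτ, hf1, ?_⟩
  -- `log f(k) = z`
  have hlogf : ((padicLogAlgCl ℓ (∏ v ∈ L, ((Ψ (localUnits v (globalToLocalUnits v k)) :
      (PadicAlgCl ℓ)ˣ) : PadicAlgCl ℓ)) : PadicAlgCl ℓ) : ℂ_[ℓ]) = z := by
    rw [RoyPadic.coe_log_eq_tsum ((hf1.trans_le hεq).trans hq1), ← hιE, hFe]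
    exact BrumerPadic.logSeries_exp hzn
  rw [hlogf, hz]
  refine Finset.sum_congr rfl fun τ _ => ?_
  rw [RoyPadic.coe_log_eq_tsum ((hτ τ).trans_lt hqs1), ← hιE]

end LogLinear

end Literature.NumberTheory.GaloisRepresentations

/-! ### Part β. Test primes and elements; multiplicative independence of the conjugates -/

namespace Literature.NumberTheory.GaloisRepresentations

namespace LogLinear

open scoped NumberField
open NumberField IsDedekindDomain IsDedekindDomain.HeightOneSpectrum Filter Finset
open Literature.NumberTheory.LFunctions.NumberField (HasDirichletDensity)

variable {K : Type} [Field K] [NumberField K] {ℓ : ℕ} [Fact ℓ.Prime]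

omit [Fact ℓ.Prime] in
/-- **Good primes beyond any bound**: a place of prime norm `q` with `q ∉ 𝔮²`, outside `S`, `q > N`
(degree-one places have density one; finitely many places have norm `≤ N`). [folklore] -/
theorem exists_good_prime (S : Finset (HeightOneSpectrum (𝓞 K))) (N : ℕ) :
    ∃ v : HeightOneSpectrum (𝓞 K), (Ideal.absNorm v.asIdeal).Prime ∧
      ((Ideal.absNorm v.asIdeal : ℕ) : 𝓞 K) ∉ v.asIdeal ^ 2 ∧ v ∉ S ∧ N < Ideal.absNorm v.asIdeal := by
  classical
  have hfinN : {v : HeightOneSpectrum (𝓞 K) | Ideal.absNorm v.asIdeal ≤ N}.Finite :=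
    (Ideal.finite_setOf_absNorm_le (S := 𝓞 K) N).preimage
      (fun v _ w _ h => HeightOneSpectrum.ext h)
  have h𝓛 : HasDirichletDensity K {v : HeightOneSpectrum (𝓞 K) |
      ((Ideal.absNorm v.asIdeal).Prime → ((Ideal.absNorm v.asIdeal : ℕ) : 𝓞 K) ∉ v.asIdeal ^ 2)} 1 :=
    hasDirichletDensity_one_of_eventually (eventually_natCast_absNorm_not_mem_sq (K := K))
  have hT := hasDirichletDensity_one_setOf_prime_absNorm K
  obtain ⟨v, hv𝓛, hvT, hvF⟩ := h𝓛.exists_mem_inter_not_mem_of_one_of_pos hT one_pos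
    ((S.finite_toSet).union hfinN)
  simp only [Set.mem_setOf_eq] at hv𝓛 hvT
  simp only [Set.mem_union, Finset.mem_coe, Set.mem_setOf_eq, not_or, not_le] at hvF
  exact ⟨v, hvT, hv𝓛 hvT, hvF.1, hvF.2⟩

omit [Fact ℓ.Prime] in
/-- **A sequence of good primes with strictly increasing (hence distinct) prime norms.** [folklore] -/
theorem exists_good_seq (S : Finset (HeightOneSpectrum (𝓞 K))) :
    ∃ 𝔮 : ℕ → HeightOneSpectrum (𝓞 K), (∀ j, (Ideal.absNorm (𝔮 j).asIdeal).Prime ∧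
      ((Ideal.absNorm (𝔮 j).asIdeal : ℕ) : 𝓞 K) ∉ (𝔮 j).asIdeal ^ 2 ∧ 𝔮 j ∉ S) ∧
      StrictMono fun j => Ideal.absNorm (𝔮 j).asIdeal := by
  classical
  choose g hg using fun N : ℕ => exists_good_prime (K := K) S N
  -- iterate: `𝔮 (j+1) = g (absNorm (𝔮 j))`
  let 𝔮 : ℕ → HeightOneSpectrum (𝓞 K) := fun j => Nat.rec (g 0) (fun _ v => g (Ideal.absNorm v.asIdeal)) j
  have h𝔮0 : 𝔮 0 = g 0 := rfl
  have h𝔮s : ∀ j, 𝔮 (j + 1) = g (Ideal.absNorm (𝔮 j).asIdeal) := fun j => rfl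
  refine ⟨𝔮, fun j => ?_, strictMono_nat_of_lt_succ fun j => ?_⟩
  · cases j with
    | zero => rw [h𝔮0]; exact ⟨(hg 0).1, (hg 0).2.1, (hg 0).2.2.1⟩
    | succ j => rw [h𝔮s]; exact ⟨(hg _).1, (hg _).2.1, (hg _).2.2.1⟩
  · rw [h𝔮s]; exact (hg _).2.2.2

omit [NumberField K] [Fact ℓ.Prime] in
/-- Two distinct rational primes do not both lie in a prime ideal. [folklore] -/
theorem natCast_not_mem_of_ne {v : HeightOneSpectrum (𝓞 K)} {p q : ℕ} (hp : p.Prime) (hq : q.Prime)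
    (hpq : p ≠ q) (hpv : (p : 𝓞 K) ∈ v.asIdeal) : (q : 𝓞 K) ∉ v.asIdeal := by
  intro hqv
  have hcop : Nat.Coprime p q := (Nat.coprime_primes hp hq).mpr hpq
  obtain ⟨a, b, hab⟩ := Nat.isCoprime_iff_coprime.mpr hcop
  have h1 : (1 : 𝓞 K) ∈ v.asIdeal := by
    have : ((a * p + b * q : ℤ) : 𝓞 K) = 1 := by rw [hab]; push_cast; ring
    rw [← this]
    push_cast
    exact v.asIdeal.add_mem (v.asIdeal.mul_mem_left _ hpv) (v.asIdeal.mul_mem_left _ hqv)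
  exact v.isPrime.ne_top ((Ideal.eq_top_iff_one _).mpr h1)

/-- **Multiplicative independence of the conjugates of the test elements.**  Let `𝔮ⱼ` be places of
`K` of distinct prime norms `qⱼ` with `qⱼ ∉ 𝔮ⱼ²`, and `πⱼ ∈ Kˣ` with `(πⱼ) = 𝔮ⱼ^{H}` (`H ≥ 1`).  If
`∏ⱼ ∏_τ τ(πⱼ)^{a_τ eⱼ} = 1` in `ℚ̄_ℓ` for an integer vector `a ≠ 0` (over the embeddings
`τ : K → ℚ̄_ℓ`) and integers `eⱼ`, then all `eⱼ = 0`: take `τ₀` with `a_{τ₀} ≠ 0` and a prime `𝔔` of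
a number field `F ⊇ τ(K)` above `τ₀(𝔮_{j₀})`; by the rigidity `NumberField.ringHom_eq_of_map_mem`
only `(j₀, τ₀)` contributes to the `𝔔`-adic valuation of the product. [folklore] -/
theorem eq_zero_of_prod_prod_zpow_eq_one [DecidableEq (HeightOneSpectrum (𝓞 K))] {m : ℕ}
    (𝔮 : Fin m → HeightOneSpectrum (𝓞 K))
    (hprime : ∀ j, (Ideal.absNorm (𝔮 j).asIdeal).Prime)
    (hsq : ∀ j, ((Ideal.absNorm (𝔮 j).asIdeal : ℕ) : 𝓞 K) ∉ (𝔮 j).asIdeal ^ 2)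
    (hinj : ∀ i j, Ideal.absNorm (𝔮 i).asIdeal = Ideal.absNorm (𝔮 j).asIdeal → i = j)
    {H : ℕ} (hH : 0 < H) (π : Fin m → K)
    (hπ : ∀ j (w : HeightOneSpectrum (𝓞 K)),
      w.valuation K (π j) = if w = 𝔮 j then WithZero.exp (-(H : ℤ)) else 1)
    {a : (K →+* PadicAlgCl ℓ) → ℤ} (ha : a ≠ 0) {e : Fin m → ℤ}
    (hrel : ∏ j, ∏ τ : K →+* PadicAlgCl ℓ, τ (π j) ^ (a τ * e j) = 1) : e = 0 := by
  classical
  -- a number field `F ⊆ ℚ̄_ℓ` containing all `τ(K)`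
  obtain ⟨τ₀, hτ₀⟩ : ∃ τ₀, a τ₀ ≠ 0 := by
    by_contra h
    push Not at h
    exact ha (funext h)
  obtain ⟨F, hFfd, -, hτF⟩ := exists_intermediateField_forall_mem K K τ₀
  haveI : FiniteDimensional ℚ F := hFfd
  haveI : NumberField F := { to_charZero := inferInstance, to_finiteDimensional := hFfd }
  set τF : (K →+* PadicAlgCl ℓ) → (K →+* F) := fun τ => τ.codRestrict F (hτF τ) with hτFdef
  have hτF_val : ∀ τ (y : K), ((τF τ y : F) : PadicAlgCl ℓ) = τ y := fun _ _ => rfl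
  have hτFinj : ∀ τ τ', τF τ = τF τ' → τ = τ' := by
    intro τ τ' h
    refine RingHom.ext fun y => ?_
    rw [← hτF_val τ y, ← hτF_val τ' y, h]
  -- the relation in `F`
  have hrelF : ∏ j, ∏ τ : K →+* PadicAlgCl ℓ, (τF τ (π j)) ^ (a τ * e j) = 1 := by
    apply (IntermediateField.val F).injective
    rw [map_one, map_prod]
    rw [← hrel]
    refine Finset.prod_congr rfl fun j _ => ?_
    rw [map_prod]
    refine Finset.prod_congr rfl fun τ _ => ?_
    rw [map_zpow₀]; rfl
  funext j₀
  -- the prime `𝔔` of `F` above `τ₀(𝔮_{j₀})`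
  obtain ⟨w, hw⟩ := exists_comap_eq_of_ringHom (τF τ₀) (𝔮 j₀)
  set q₀ : ℕ := Ideal.absNorm (𝔮 j₀).asIdeal with hq₀
  have hq₀v : (q₀ : 𝓞 K) ∈ (𝔮 j₀).asIdeal := natCast_absNorm_mem_asIdeal _
  have hq₀w : (q₀ : 𝓞 F) ∈ w.asIdeal := by
    have h1 : RingOfIntegers.mapRingHom (τF τ₀) (q₀ : 𝓞 K) ∈ w.asIdeal := by
      rw [← Ideal.mem_comap, hw]; exact hq₀v
    rwa [map_natCast] at h1
  -- the pair `(j₀, τ₀)` is the only contributor at `w`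
  have honly : ∀ j (τ : K →+* PadicAlgCl ℓ) (𝔮' : HeightOneSpectrum (𝓞 K)),
      𝔮'.asIdeal = Ideal.comap (RingOfIntegers.mapRingHom (τF τ)) w.asIdeal → 𝔮' = 𝔮 j →
      j = j₀ ∧ τ = τ₀ := by
    intro j τ 𝔮' h𝔮' h𝔮'j
    -- `q₀ ∈ 𝔮' = 𝔮 j`, so `q_j = q₀` and `j = j₀`
    have hq₀𝔮' : (q₀ : 𝓞 K) ∈ 𝔮'.asIdeal := by
      rw [h𝔮', Ideal.mem_comap, map_natCast]; exact hq₀w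
    have hjj : j = j₀ := by
      by_contra hne
      have hne' : Ideal.absNorm (𝔮 j).asIdeal ≠ q₀ := fun h => hne (hinj j j₀ h)
      rw [h𝔮'j] at hq₀𝔮'
      exact natCast_not_mem_of_ne (hprime j) (hprime j₀) hne' (natCast_absNorm_mem_asIdeal _) hq₀𝔮'
    subst hjj
    refine ⟨rfl, hτFinj τ τ₀ ?_⟩
    refine NumberField.ringHom_eq_of_map_mem (𝔮 j) (hprime j) rfl (hsq j) w.isPrime.ne_top (τF τ) (τF τ₀)
      (fun a ha' => ?_) (fun a ha' => ?_)
    · rw [← Ideal.mem_comap, ← h𝔮', h𝔮'j]; exact ha'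
    · rw [← Ideal.mem_comap, hw]; exact ha'
  have hone : ∀ j (τ : K →+* PadicAlgCl ℓ), ¬ (j = j₀ ∧ τ = τ₀) → w.valuation F (τF τ (π j)) = 1 := by
    intro j τ hjτ
    obtain ⟨𝔮', e', -, h𝔮', hv'⟩ := exists_valuation_comp_eq_pow (τF τ) w
    rw [hv', hπ]
    by_cases h : 𝔮' = 𝔮 j
    · exact absurd (honly j τ 𝔮' h𝔮' h) hjτ
    · rw [if_neg h, one_pow]
  obtain ⟨𝔮₀, e₀, he₀, h𝔮₀, hv₀⟩ := exists_valuation_comp_eq_pow (τF τ₀) w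
  have h𝔮₀eq : 𝔮₀ = 𝔮 j₀ := HeightOneSpectrum.ext (h𝔮₀.trans hw)
  have hkey₀ : w.valuation F (τF τ₀ (π j₀)) = (WithZero.exp (-(H : ℤ))) ^ e₀ := by
    rw [hv₀, hπ, if_pos h𝔮₀eq]
  -- take `|·|_w` of the relation
  have hv := congrArg (w.valuation F) hrelF
  rw [map_prod, map_one] at hv
  simp only [map_prod, map_zpow₀] at hv
  rw [Finset.prod_eq_single j₀ (fun j _ hj => Finset.prod_eq_one fun τ _ => by
      rw [hone j τ (fun h => hj h.1), one_zpow]) (fun h => absurd (Finset.mem_univ j₀) h),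
    Finset.prod_eq_single τ₀ (fun τ _ hτ => by rw [hone j₀ τ (fun h => hτ h.2), one_zpow])
      (fun h => absurd (Finset.mem_univ τ₀) h), hkey₀, ← zpow_natCast, ← zpow_mul,
    ← WithZero.exp_zsmul, ← WithZero.exp_zero, WithZero.exp_inj, smul_eq_mul] at hv
  have hint : (e₀ : ℤ) * (a τ₀ * e j₀) * (H : ℤ) = 0 := by linarith
  simp only [mul_eq_zero, Nat.cast_eq_zero, he₀.ne', hτ₀, hH.ne', false_or, or_false] at hint
  exact hint

/-- **Test elements.**  For finite sets `S` and `L = S_ℓ` of places, a depth `M` and a size `m`,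
there are places `𝔮ⱼ ∉ S ∪ L` (`j < m`) of distinct prime norms `qⱼ ∉ 𝔮ⱼ²`, an exponent `H ≥ 1`
and units `πⱼ ∈ Kˣ` with `(πⱼ) = 𝔮ⱼ^H` and `πⱼ ≡ 1 mod 𝔭_v^M` at every `v ∈ L` (uniform ray-class
principalisation, `exists_uniform_rayClass_principalization`). [folklore] -/
theorem exists_test_family [DecidableEq (HeightOneSpectrum (𝓞 K))]
    (S L : Finset (HeightOneSpectrum (𝓞 K))) (M m : ℕ) :
    ∃ (𝔮 : Fin m → HeightOneSpectrum (𝓞 K)) (π : Fin m → Kˣ) (H : ℕ), 0 < H ∧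
      (∀ j, (Ideal.absNorm (𝔮 j).asIdeal).Prime ∧
        ((Ideal.absNorm (𝔮 j).asIdeal : ℕ) : 𝓞 K) ∉ (𝔮 j).asIdeal ^ 2 ∧ 𝔮 j ∉ S ∧ 𝔮 j ∉ L) ∧
      (∀ i j, Ideal.absNorm (𝔮 i).asIdeal = Ideal.absNorm (𝔮 j).asIdeal → i = j) ∧
      (∀ j (w : HeightOneSpectrum (𝓞 K)),
        w.valuation K ((π j : Kˣ) : K) = if w = 𝔮 j then WithZero.exp (-(H : ℤ)) else 1) ∧
      (∀ j, ∀ v ∈ L, Valued.v (algebraMap K (v.adicCompletion K) ((π j : Kˣ) : K) - 1) ≤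
        WithZero.exp (-(M : ℤ))) := by
  classical
  -- the level and the uniform principalisation exponent
  set 𝔪 : Ideal (𝓞 K) := ∏ u ∈ L, u.asIdeal ^ (M + 1) with h𝔪def
  obtain ⟨H, hH, hprin⟩ := exists_uniform_rayClass_principalization (prod_pow_ne_bot L (M + 1))
  -- the primes
  obtain ⟨𝔮ℕ, hgood, hmono⟩ := exists_good_seq (K := K) (S ∪ L)
  set 𝔮 : Fin m → HeightOneSpectrum (𝓞 K) := fun j => 𝔮ℕ j with h𝔮def
  have h𝔮L : ∀ j, 𝔮 j ∉ L := fun j h => (hgood j).2.2 (Finset.mem_union_right _ h)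
  have h𝔮S : ∀ j, 𝔮 j ∉ S := fun j h => (hgood j).2.2 (Finset.mem_union_left _ h)
  -- the generators
  have hgen : ∀ j, ∃ π : Kˣ, (∀ w : HeightOneSpectrum (𝓞 K),
      w.valuation K ((π : Kˣ) : K) = if w = 𝔮 j then WithZero.exp (-(H : ℤ)) else 1) ∧
      ∀ v ∈ L, Valued.v (algebraMap K (v.adicCompletion K) ((π : Kˣ) : K) - 1) ≤
        WithZero.exp (-(M : ℤ)) := by
    intro j
    obtain ⟨b, c, hb, hc, hccop, hbc, hideal⟩ :=
      hprin (𝔮 j).asIdeal (𝔮 j).ne_bot (isCoprime_prod_pow_of_not_mem L (M + 1) (h𝔮L j))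
    have hb' : (b : K) ≠ 0 := by exact_mod_cast hb
    have hc' : (c : K) ≠ 0 := by exact_mod_cast hc
    refine ⟨Units.mk0 ((b : K) / c) (div_ne_zero hb' hc'), fun w => ?_, fun v hv => ?_⟩
    · rw [Units.val_mk0]
      convert valuation_div_eq_of_span_mul_pow_eq (𝔮 j) hb hc hideal w using 2
    · rw [Units.val_mk0]
      have hle : 𝔪 ≤ v.asIdeal ^ (M + 1) := prod_pow_le_pow L (M + 1) hv
      refine (valued_div_sub_one_le v (hle hbc) (not_mem_of_isCoprime_span_of_le v hccop
        (hle.trans (Ideal.pow_le_self (Nat.succ_ne_zero M))))).trans ?_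
      exact WithZero.exp_le_exp.mpr (by omega)
  choose π hπ hπc using hgen
  refine ⟨𝔮, π, H, hH, fun j => ⟨(hgood j).1, (hgood j).2.1, h𝔮S j, h𝔮L j⟩, fun i j hij => ?_, hπ, hπc⟩
  exact Fin.ext (hmono.injective hij)

end LogLinear

end Literature.NumberTheory.GaloisRepresentations

/-! ### Part γ. The linear subgroup theorem as a rank bound on integer rows -/

namespace Literature.NumberTheory.GaloisRepresentations

namespace LogLinear

open Module
open Literature.NumberTheory.Transcendental
open Literature.NumberTheory.Transcendental.RoyRank (LinTangent IsFLogSubspace IsFRational IsFPoint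
  IsAdmissible Omega Thm1 omega_zero isFRational_bot)

variable {ℓ : ℕ} [Fact ℓ.Prime]

/-- **From Waldschmidt's linear subgroup theorem** (Roy 1992 Thm. 1 for `ℚ̄_ℓ`, `ω = 0`, proved in
the tree as `RoyPadic.thm1_holds`): if finitely many vectors `P_j ∈ ℚ̄_ℓ^D` with coordinates in
Roy's `L` (rational combinations of `ℓ`-adic logarithms of algebraic principal units) all lie in
a PROPER `ℚ̄_ℓ`-subspace `V`, then there is a non-zero integer row `a ∈ ℤ^D` such that the
`ℚ`-span of the numbers `∑ᵢ aᵢ P_{j,i}` has dimension `≤ D²` (the data `d₀ = 0`, `d₁ = D`,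
`Y = ℚ·{P_j}`, `W = 0` of Roy's Theorem 1; the row is the first coordinate of the admissible map
`s`, cleared of denominators). [cite: Roy1992, §1 Theorem 1 (p. 25)] [cite: Waldschmidt1988, Thm 4.1] -/
theorem exists_intRow_of_thm1 {D m : ℕ} (P : Fin m → (Fin D → PadicAlgCl ℓ))
    (hP : ∀ j i, P j i ∈ RoyPadic.logQSpan ℓ)
    (V : Submodule (PadicAlgCl ℓ) (Fin D → PadicAlgCl ℓ)) (hPV : ∀ j, P j ∈ V) (hV : V ≠ ⊤) :
    ∃ a : Fin D → ℤ, a ≠ 0 ∧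
      finrank ℚ (Submodule.span ℚ (Set.range fun j : Fin m => ∑ i, (a i : PadicAlgCl ℓ) * P j i)) ≤ D * D := by
  classical
  -- the pairing `y ↦ (0, y)`
  set e : (Fin D → PadicAlgCl ℓ) →ₗ[PadicAlgCl ℓ] LinTangent (PadicAlgCl ℓ) 0 D :=
    LinearMap.inr (PadicAlgCl ℓ) (Fin 0 → PadicAlgCl ℓ) (Fin D → PadicAlgCl ℓ) with he
  have he_apply : ∀ y, e y = ((0 : Fin 0 → PadicAlgCl ℓ), y) := fun y => rfl
  have hpair : ∀ v : LinTangent (PadicAlgCl ℓ) 0 D, v = e v.2 := by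
    intro v; rw [he_apply]; ext i
    · exact Fin.elim0 i
    · rfl
  -- Roy's data
  set Y : Submodule ℚ (LinTangent (PadicAlgCl ℓ) 0 D) :=
    Submodule.span ℚ (Set.range fun j => e (P j)) with hY
  haveI hYfd : FiniteDimensional ℚ Y := FiniteDimensional.span_of_finite ℚ (Set.finite_range _)
  have hYlog : IsFLogSubspace (padicQbar ℓ) (RoyPadic.logQSpan ℓ) Y := by
    intro y hy
    refine ⟨fun i => Fin.elim0 i, ?_⟩
    refine Submodule.span_induction (p := fun y _ => ∀ j, y.2 j ∈ RoyPadic.logQSpan ℓ) ?_ ?_ ?_ ?_ hy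
    · rintro _ ⟨j, rfl⟩ i; exact hP j i
    · intro i; exact Submodule.zero_mem _
    · intro x y _ _ hx hy i; exact Submodule.add_mem _ (hx i) (hy i)
    · intro q x _ hx i
      change (q • x).2 i ∈ _
      rw [Prod.smul_snd, Pi.smul_apply]
      exact Submodule.smul_mem _ q (hx i)
  set V' : Submodule (PadicAlgCl ℓ) (LinTangent (PadicAlgCl ℓ) 0 D) := V.map e with hV'
  have hYV : Y ≤ V'.restrictScalars ℚ := by
    rw [hY, Submodule.span_le]
    rintro _ ⟨j, rfl⟩
    exact Submodule.mem_map_of_mem (hPV j)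
  have hWV : (⊥ : Submodule (PadicAlgCl ℓ) (LinTangent (PadicAlgCl ℓ) 0 D)) ≤ V' := bot_le
  have hV'ne : V' ≠ ⊤ := by
    intro htop
    apply hV
    rw [eq_top_iff]
    intro y _
    have : e y ∈ V' := htop ▸ Submodule.mem_top
    obtain ⟨y', hy', hyy'⟩ := Submodule.mem_map.mp this
    have : y' = y := by
      have := congrArg Prod.snd hyy'
      simpa [he_apply] using this
    rw [← this]; exact hy'
  -- Theorem 1
  obtain ⟨d₀', d₁', s, hadm, hW, hineq⟩ := RoyPadic.thm1_holds ℓ 0 D Y ⊥ V' hYfd hYlog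
    (isFRational_bot _) hYV hWV hV'ne
  -- ### the admissible map: zero first component, a rational row
  obtain ⟨hsurj, -, hrat⟩ := hadm
  have hfst : ∀ v, (s v).1 = 0 := by
    -- rational vectors span, and `s (0, y)` has zero first component on them
    have hbasis : ∀ y : Fin D → PadicAlgCl ℓ, (s (e y)).1 = 0 := by
      intro y
      have hy : y = ∑ i, y i • (Pi.single i (1 : PadicAlgCl ℓ) : Fin D → PadicAlgCl ℓ) := by
        ext k; simp [Finset.sum_apply, Pi.single_apply]
      rw [hy, map_sum, map_sum, Prod.fst_sum]
      refine Finset.sum_eq_zero fun i _ => ?_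
      rw [LinearMap.map_smul, LinearMap.map_smul, Prod.smul_fst, he_apply]
      have := (hrat (Pi.single i 1) (fun j => ?_)).1
      · rw [this, smul_zero]
      · by_cases hij : j = i
        · subst hij; exact ⟨1, by simp⟩
        · exact ⟨0, by simp [hij]⟩
    intro v; rw [hpair v]; exact hbasis v.2
  have hall1 : ∀ w : LinTangent (PadicAlgCl ℓ) d₀' d₁', w.1 = 0 := fun w => by
    obtain ⟨v, rfl⟩ := hsurj w; exact hfst v
  -- hence `d₁' ≥ 1`
  have hd₁' : 0 < d₁' := by
    by_contra h0
    obtain rfl : d₁' = 0 := by omega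
    apply hW
    rw [Submodule.map_bot, eq_comm, eq_bot_iff]
    intro w _
    have hw0 : w = 0 := by
      ext i
      · exact congrFun (hall1 w) i
      · exact Fin.elim0 i
    rw [hw0]; exact Submodule.zero_mem _
  set i₀ : Fin d₁' := ⟨0, hd₁'⟩ with hi₀
  -- the row functional `r y = (s (0, y)).2 i₀` and its rational values on the standard basis
  have hrow : ∀ i : Fin D, ∃ q : ℚ, (s (e (Pi.single i 1))).2 i₀ = algebraMap ℚ (PadicAlgCl ℓ) q := by
    intro i
    have := (hrat (Pi.single i 1) (fun j => ?_)).2 i₀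
    · obtain ⟨q, hq⟩ := this; exact ⟨q, hq.symm⟩
    · by_cases hij : j = i
      · subst hij; exact ⟨1, by simp⟩
      · exact ⟨0, by simp [hij]⟩
  choose ρ hρ using hrow
  -- linearity of the row in `y`
  have hlin : ∀ y : Fin D → PadicAlgCl ℓ,
      (s (e y)).2 i₀ = ∑ i, y i * algebraMap ℚ (PadicAlgCl ℓ) (ρ i) := by
    intro y
    have hy : y = ∑ i, y i • (Pi.single i (1 : PadicAlgCl ℓ) : Fin D → PadicAlgCl ℓ) := by
      ext k; simp [Finset.sum_apply, Pi.single_apply]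
    conv_lhs => rw [hy]
    rw [map_sum, map_sum, Prod.snd_sum, Finset.sum_apply]
    refine Finset.sum_congr rfl fun i _ => ?_
    rw [LinearMap.map_smul, LinearMap.map_smul, Prod.smul_snd, Pi.smul_apply, hρ i, smul_eq_mul]
  -- the row is non-zero (the coordinate `i₀` of `s` is onto)
  have hρne : ρ ≠ 0 := by
    intro hρ0
    obtain ⟨v, hv⟩ := hsurj ((0 : Fin d₀' → PadicAlgCl ℓ), Pi.single i₀ 1)
    have h1 : (s v).2 i₀ = 1 := by rw [hv]; simp
    rw [hpair v, hlin] at h1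
    simp [hρ0] at h1
  -- clear denominators: `a i = N₀ ρ i ∈ ℤ`
  set N₀ : ℕ := ∏ i, (ρ i).den with hN₀
  have hN₀pos : 0 < N₀ := Finset.prod_pos fun i _ => (ρ i).den_pos
  set a : Fin D → ℤ := fun i => (ρ i).num * ∏ j ∈ Finset.univ.erase i, ((ρ j).den : ℤ) with ha
  have haq : ∀ i, (a i : ℚ) = (N₀ : ℚ) * ρ i := by
    intro i
    rw [ha]; dsimp only
    rw [hN₀, ← Finset.mul_prod_erase Finset.univ (fun j => (ρ j).den) (Finset.mem_univ i)]
    push_cast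
    rw [mul_comm ((ρ i).den : ℚ), mul_assoc, mul_comm ((ρ i).den : ℚ) (ρ i), Rat.mul_den_eq_num]
    ring
  have hane : a ≠ 0 := by
    intro ha0
    apply hρne
    funext i
    have := haq i
    rw [ha0, Pi.zero_apply, Int.cast_zero, eq_comm, mul_eq_zero] at this
    rcases this with h | h
    · exact absurd (by exact_mod_cast h) hN₀pos.ne'
    · exact h
  refine ⟨a, hane, ?_⟩
  -- ### the rank bound from the inequality of Theorem 1
  have hfV' : finrank (PadicAlgCl ℓ) V' < D := by
    have h := Submodule.finrank_lt hV'ne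
    rwa [Module.finrank_prod, Module.finrank_fin_fun, Module.finrank_fin_fun, zero_add] at h
  have htarget : d₀' + d₁' ≤ D := by
    have h := LinearMap.finrank_le_finrank_of_surjective hsurj
    rwa [Module.finrank_prod, Module.finrank_fin_fun, Module.finrank_fin_fun, Module.finrank_prod,
      Module.finrank_fin_fun, Module.finrank_fin_fun, zero_add] at h
  have e1 : finrank ℚ ↥(Y.map (s.restrictScalars ℚ) ⊓ Omega (0 : PadicAlgCl ℓ) d₀' d₁') = 0 := by
    rw [omega_zero, inf_bot_eq, finrank_bot]
  have e2 : finrank ℚ ↥(Y ⊓ Omega (0 : PadicAlgCl ℓ) 0 D) = 0 := by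
    rw [omega_zero, inf_bot_eq, finrank_bot]
  have e3 : finrank (PadicAlgCl ℓ) ↥((⊥ : Submodule (PadicAlgCl ℓ) (LinTangent (PadicAlgCl ℓ) 0 D)).map s) = 0 := by
    rw [Submodule.map_bot, finrank_bot]
  rw [e1, e2, e3] at hineq
  simp only [Nat.cast_zero, sub_zero, zero_add] at hineq
  set fY : ℕ := finrank ℚ ↥(Y.map (s.restrictScalars ℚ)) with hfY
  have hfYle : fY ≤ D * D := by
    have hden1 : (0 : ℝ) < (d₀' : ℝ) + d₁' := by
      have : (1 : ℝ) ≤ d₁' := by exact_mod_cast hd₁'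
      positivity
    have hden2 : (1 : ℝ) ≤ (D : ℝ) - finrank (PadicAlgCl ℓ) V' := by
      have : (finrank (PadicAlgCl ℓ) V' : ℝ) + 1 ≤ D := by exact_mod_cast hfV'
      linarith
    rw [div_le_div_iff₀ hden1 (by linarith)] at hineq
    have hD0 : (0 : ℝ) ≤ D := by positivity
    have hsum : (d₀' : ℝ) + d₁' ≤ D := by exact_mod_cast htarget
    have hfY0 : (0 : ℝ) ≤ fY := by positivity
    have key : ((d₁' : ℝ) + fY) * 1 ≤ (D : ℝ) * D := by
      calc ((d₁' : ℝ) + fY) * 1 ≤ ((d₁' : ℝ) + fY) * ((D : ℝ) - finrank (PadicAlgCl ℓ) V') :=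
            mul_le_mul_of_nonneg_left hden2 (by positivity)
        _ ≤ (D : ℝ) * ((d₀' : ℝ) + d₁') := hineq
        _ ≤ (D : ℝ) * D := mul_le_mul_of_nonneg_left hsum hD0
    have : (fY : ℝ) ≤ (D : ℝ) * D := by nlinarith
    exact_mod_cast this
  -- ### the span of the row values is an image of `s(Y)`
  set φ : LinTangent (PadicAlgCl ℓ) d₀' d₁' →ₗ[ℚ] PadicAlgCl ℓ :=
    (N₀ : ℚ) • ((LinearMap.proj i₀ : (Fin d₁' → PadicAlgCl ℓ) →ₗ[PadicAlgCl ℓ] PadicAlgCl ℓ).comp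
      (LinearMap.snd (PadicAlgCl ℓ) (Fin d₀' → PadicAlgCl ℓ) (Fin d₁' → PadicAlgCl ℓ))).restrictScalars ℚ
    with hφ
  have hφ_apply : ∀ w, φ w = (N₀ : ℚ) • w.2 i₀ := fun w => rfl
  have hφval : ∀ j, φ (s (e (P j))) = ∑ i, (a i : PadicAlgCl ℓ) * P j i := by
    intro j
    rw [hφ_apply, hlin, Finset.smul_sum]
    refine Finset.sum_congr rfl fun i _ => ?_
    have : (a i : PadicAlgCl ℓ) = algebraMap ℚ (PadicAlgCl ℓ) (a i : ℚ) := by simp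
    rw [this, haq, map_mul, map_natCast, Rat.smul_def]
    push_cast
    ring
  have hspan : Submodule.span ℚ (Set.range fun j : Fin m => ∑ i, (a i : PadicAlgCl ℓ) * P j i) =
      (Y.map (s.restrictScalars ℚ)).map φ := by
    have hr : (Set.range fun j : Fin m => ∑ i, (a i : PadicAlgCl ℓ) * P j i) =
        Set.range (φ ∘ (s.restrictScalars ℚ) ∘ fun j => e (P j)) := by
      refine congrArg Set.range ?_
      funext j
      exact (hφval j).symm
    rw [hY, Submodule.map_span, Submodule.map_span, ← Set.range_comp, ← Set.range_comp, hr]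
  rw [hspan]
  haveI : Module.Finite ℚ ↥(Y.map (s.restrictScalars ℚ)) := inferInstance
  exact (Submodule.finrank_map_le φ _).trans hfYle

end LogLinear

end Literature.NumberTheory.GaloisRepresentations

/-! ### Part δ₁. Small helpers: Iwasawa logarithm of products, principal units, congruences -/

namespace Literature.NumberTheory.GaloisRepresentations

namespace LogLinear

open scoped NumberField
open NumberField IsDedekindDomain IsDedekindDomain.HeightOneSpectrum Filter Finset
open Literature.NumberTheory.Transcendental

variable {K : Type} [Field K] [NumberField K] {ℓ : ℕ} [Fact ℓ.Prime]

/-- `log_ℓ (xⁿ) = n log_ℓ x` (`n ∈ ℤ`, `x ≠ 0`). [cite: LangCyclotomic1990, Ch. 4, Appendix to §3] -/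
theorem log_zpow' {x : PadicAlgCl ℓ} (hx : x ≠ 0) (n : ℤ) :
    padicLogAlgCl ℓ (x ^ n) = n * padicLogAlgCl ℓ x :=
  (padicLogAlgCl_isIwasawaLog_holds ℓ).log_zpow hx n

/-- `log_ℓ` of a finite product of non-zero elements. [cite: LangCyclotomic1990, Ch. 4, Appendix to §3] -/
theorem log_finset_prod {ι : Type*} (s : Finset ι) (x : ι → PadicAlgCl ℓ)
    (hx : ∀ i ∈ s, x i ≠ 0) :
    padicLogAlgCl ℓ (∏ i ∈ s, x i) = ∑ i ∈ s, padicLogAlgCl ℓ (x i) := by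
  classical
  induction s using Finset.induction_on with
  | empty => simp [(padicLogAlgCl_isIwasawaLog_holds ℓ).log_one]
  | insert a s ha ih =>
    rw [Finset.prod_insert ha, Finset.sum_insert ha,
      IwasawaLog.log_mul (hx a (Finset.mem_insert_self a s))
        (Finset.prod_ne_zero_iff.mpr fun i hi => hx i (Finset.mem_insert_of_mem hi)),
      ih fun i hi => hx i (Finset.mem_insert_of_mem hi)]

omit [Fact ℓ.Prime] in
/-- Principal units: `‖1 − xy‖ ≤ max ‖1 − x‖ ‖1 − y‖` when `‖1 − x‖ ≤ 1`. [folklore] -/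
theorem norm_one_sub_mul_le {F : Type*} [NormedField F] [IsUltrametricDist F] {x y : F}
    (hx : ‖1 - x‖ ≤ 1) : ‖1 - x * y‖ ≤ max ‖1 - x‖ ‖1 - y‖ := by
  have hx1 : ‖x‖ ≤ 1 := by
    have : x = 1 + -(1 - x) := by ring
    rw [this]
    refine (IsUltrametricDist.norm_add_le_max _ _).trans ?_
    rw [norm_neg, norm_one]
    exact max_le le_rfl hx
  have e : 1 - x * y = (1 - x) + x * (1 - y) := by ring
  rw [e]
  refine (IsUltrametricDist.norm_add_le_max _ _).trans (max_le_max le_rfl ?_)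
  rw [norm_mul]
  exact mul_le_of_le_one_left (norm_nonneg _) hx1

omit [Fact ℓ.Prime] in
/-- Principal units: `‖1 − x⁻¹‖ = ‖1 − x‖` when `‖1 − x‖ < 1`. [folklore] -/
theorem norm_one_sub_inv {F : Type*} [NormedField F] [IsUltrametricDist F] {x : F}
    (hx : ‖1 - x‖ < 1) : ‖1 - x⁻¹‖ = ‖1 - x‖ := by
  have hx1 : ‖x‖ = 1 := by
    have e : x = 1 + -(1 - x) := by ring
    have hne : ‖(1 : F)‖ ≠ ‖-(1 - x)‖ := by
      rw [norm_neg, norm_one]; exact (ne_of_gt hx)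
    rw [e, IsUltrametricDist.norm_add_eq_max_of_norm_ne_norm hne, norm_neg, norm_one,
      max_eq_left hx.le]
  have hx0 : x ≠ 0 := fun h => by simp [h] at hx1
  have e : 1 - x⁻¹ = -(x⁻¹ * (1 - x)) := by field_simp; ring
  rw [e, norm_neg, norm_mul, norm_inv, hx1, inv_one, one_mul]

omit [Fact ℓ.Prime] in
/-- Principal units: `‖1 − xⁿ‖ ≤ ‖1 − x‖` for `n ∈ ℤ` when `‖1 − x‖ < 1`. [folklore] -/
theorem norm_one_sub_zpow_le {F : Type*} [NormedField F] [IsUltrametricDist F] {x : F}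
    (hx : ‖1 - x‖ < 1) (n : ℤ) : ‖1 - x ^ n‖ ≤ ‖1 - x‖ := by
  have hpow : ∀ (y : F), ‖1 - y‖ < 1 → ∀ k : ℕ, ‖1 - y ^ k‖ ≤ ‖1 - y‖ := by
    intro y hy k
    induction k with
    | zero => simp
    | succ k ih =>
      rw [pow_succ]
      refine (norm_one_sub_mul_le (ih.trans hy.le)).trans (max_le ih le_rfl)
  cases n with
  | ofNat k => rw [Int.ofNat_eq_natCast, zpow_natCast]; exact hpow x hx k
  | negSucc k =>
    rw [zpow_negSucc, ← inv_pow]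
    have hinv : ‖1 - x⁻¹‖ < 1 := by rw [norm_one_sub_inv hx]; exact hx
    exact (hpow _ hinv (k + 1)).trans (norm_one_sub_inv hx).le

omit [Fact ℓ.Prime] in
/-- Principal units: a finite product of elements with `‖1 − xᵢ‖ ≤ r ≤ 1` has `‖1 − ∏ xᵢ‖ ≤ r`.
[folklore] -/
theorem norm_one_sub_prod_le {F : Type*} [NormedField F] [IsUltrametricDist F] {ι : Type*}
    (s : Finset ι) (x : ι → F) {r : ℝ} (hr0 : 0 ≤ r) (hr : r ≤ 1) (hx : ∀ i ∈ s, ‖1 - x i‖ ≤ r) :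
    ‖1 - ∏ i ∈ s, x i‖ ≤ r := by
  classical
  induction s using Finset.induction_on with
  | empty => simpa using hr0
  | insert a s ha ih =>
    rw [Finset.prod_insert ha]
    have h1 := hx a (Finset.mem_insert_self a s)
    exact (norm_one_sub_mul_le (h1.trans hr)).trans
      (max_le h1 (ih fun i hi => hx i (Finset.mem_insert_of_mem hi)))

/-- **Injectivity of `log_ℓ` near `1`**: a principal unit `x ∈ ℚ̄_ℓ` with `‖1 − x‖ ≤ 1/4` and
`log_ℓ x = 0` is `1` (isometry of the logarithmic series, read in `ℂ_ℓ`). [folklore] -/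
theorem eq_one_of_log_eq_zero {x : PadicAlgCl ℓ} (hx : ‖1 - x‖ ≤ 1 / 4)
    (h0 : padicLogAlgCl ℓ x = 0) : x = 1 := by
  have hx1 : ‖1 - x‖ < 1 := hx.trans_lt (by norm_num)
  have hc := RoyPadic.coe_log_eq_tsum hx1
  rw [h0] at hc
  have hxC : ‖(1 : ℂ_[ℓ]) - (x : ℂ_[ℓ])‖ ≤ 1 / 4 := by rw [RoyPadic.norm_one_sub_coe]; exact hx
  have hn := LogE.norm_logSeries_eq (ℓ := ℓ) hxC
  rw [← hc] at hn
  simp only [UniformSpace.Completion.coe_zero, norm_zero] at hn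
  have : (x : ℂ_[ℓ]) = 1 := by
    have h := norm_eq_zero.mp hn.symm
    rw [sub_eq_zero] at h
    exact h.symm
  exact UniformSpace.Completion.coe_injective (PadicAlgCl ℓ)
    (this.trans (UniformSpace.Completion.coe_one (PadicAlgCl ℓ)).symm)

omit [Fact ℓ.Prime] in
/-- `u ≡ 1 [ℓ^s]`, `s ≥ 1` ⇒ `u^e ≡ 1 [ℓ^s]` for every `e ∈ ℤ`. [folklore] -/
theorem cong_zpow_sub_one {s : ℕ} (hs : 1 ≤ s) {u : K}
    (hu : ∀ v : HeightOneSpectrum (𝓞 K), (ℓ : 𝓞 K) ∈ v.asIdeal →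
      v.valuation K (u - 1) ≤ v.valuation K ((ℓ : K) ^ s)) (e : ℤ) :
    ∀ v : HeightOneSpectrum (𝓞 K), (ℓ : 𝓞 K) ∈ v.asIdeal →
      v.valuation K (u ^ e - 1) ≤ v.valuation K ((ℓ : K) ^ s) := by
  have hpow : ∀ k : ℕ, ∀ v : HeightOneSpectrum (𝓞 K), (ℓ : 𝓞 K) ∈ v.asIdeal →
      v.valuation K (u ^ k - 1) ≤ v.valuation K ((ℓ : K) ^ s) := by
    intro k
    have := Cong.prod_sub_one (ℓ := ℓ) (Finset.range k) (fun _ => u) (fun _ _ => hu)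
    simpa [Finset.prod_const, Finset.card_range] using this
  cases e with
  | ofNat k => rw [Int.ofNat_eq_natCast, zpow_natCast]; exact hpow k
  | negSucc k =>
    rw [zpow_negSucc, ← one_div]
    exact Quadratic.cong_div_sub_one hs (fun v hv => by simp) (hpow (k + 1))

end LogLinear

end Literature.NumberTheory.GaloisRepresentations

/-! ### Part δ₂. Block kernels (linear algebra) -/

namespace Literature.NumberTheory.GaloisRepresentations

namespace LogLinear

open scoped NumberField
open NumberField IsDedekindDomain IsDedekindDomain.HeightOneSpectrum Filter Finset Module
open Literature.NumberTheory.Transcendental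

variable {K : Type} [Field K] [NumberField K] {ℓ : ℕ} [Fact ℓ.Prime]

omit [Fact ℓ.Prime] in
/-- **Block kernels.**  `R` vectors spanning a `ℚ`-space of dimension `< R` satisfy a non-trivial
INTEGER linear relation. [folklore] -/
theorem exists_int_relation {V : Type*} [AddCommGroup V] [Module ℚ V] {R : ℕ} (x : Fin R → V)
    (hR : finrank ℚ (Submodule.span ℚ (Set.range x)) < R) :
    ∃ g : Fin R → ℤ, g ≠ 0 ∧ ∑ r, (g r : ℚ) • x r = 0 := by
  classical
  have hnot : ¬ LinearIndependent ℚ x := by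
    intro hli
    have := linearIndependent_iff_card_eq_finrank_span.mp hli
    rw [Fintype.card_fin] at this
    change R = finrank ℚ (Submodule.span ℚ (Set.range x)) at this
    omega
  obtain ⟨c, hc, r₀, hr₀⟩ := Fintype.not_linearIndependent_iff.mp hnot
  set N₀ : ℕ := ∏ r, (c r).den with hN₀
  have hN₀pos : 0 < N₀ := Finset.prod_pos fun r _ => (c r).den_pos
  set g : Fin R → ℤ := fun r => (c r).num * ∏ j ∈ Finset.univ.erase r, ((c j).den : ℤ) with hg
  have hgq : ∀ r, (g r : ℚ) = (N₀ : ℚ) * c r := by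
    intro r
    rw [hg]; dsimp only
    rw [hN₀, ← Finset.mul_prod_erase Finset.univ (fun j => (c j).den) (Finset.mem_univ r)]
    push_cast
    rw [mul_comm ((c r).den : ℚ), mul_assoc, mul_comm ((c r).den : ℚ) (c r), Rat.mul_den_eq_num]
    ring
  refine ⟨g, fun hg0 => hr₀ ?_, ?_⟩
  · have := hgq r₀
    rw [hg0, Pi.zero_apply, Int.cast_zero, eq_comm, mul_eq_zero] at this
    rcases this with h | h
    · exact absurd (by exact_mod_cast h) hN₀pos.ne'
    · exact h
  · simp_rw [hgq, mul_smul, ← Finset.smul_sum, hc, smul_zero]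

/-! ### Part δ₃. Theorem 2.2 for every number field -/

/-- **Bockle–Hui Theorem 2.2 / Serre–Waldschmidt–Henniart, for EVERY number field `K`**: for a
rank-one `ℓ`-adic Galois character `ψ` with idelic avatar `Ψ` whose Frobenius values are almost
all algebraic, a positive power of `Ψ` is locally algebraic — at every deep enough `k ∈ Kˣ`,
`(∏_{v | ℓ} Ψ(⟨k⟩_v))^N = ∏_τ τ(k)^{−n_τ}`.  Proof: the log-linear relation
(`exists_logLinear`, from the analytic expansion of FILE A) puts the vectors
`P(k) = (log_ℓ τ(k))_τ ⊕ log_ℓ f(k)` of Roy's `L^{d+1}` in a proper `ℚ̄_ℓ`-subspace `V`;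
Waldschmidt's linear subgroup theorem (`RoyPadic.thm1_holds`, through `exists_intRow_of_thm1`)
applied to the `P(πⱼ)` of ray-class generators `πⱼ` of many degree-one primes gives an integer
row `(n, a)` with `β = f^a · ∏ τ^{n_τ}` of bounded rank on the `πⱼ`; `a ≠ 0` and the block
kernels `κ_t ∈ ker β` have conjugate-logarithm vectors spanning `ℚ̄_ℓ^d` (a second application
of the linear subgroup theorem and the independence `eq_zero_of_prod_prod_zpow_eq_one`), whence
`V = ker⟨(n,a), ·⟩` and `β ≡ 1` on the congruence subgroup.
[cite: BockleHui2025, Thm 2.2 and §2.7 Step 1] [cite: SerreAbelianLadic1968, Ch. III §3]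
[cite: Roy1992, §1 Theorem 1] [cite: Waldschmidt1988, Thm 4.1] -/
theorem pow_isLocallyAlgebraic_of_frobenius_isAlgebraic
    (ψ : FramedGaloisRep K (PadicAlgCl ℓ) 1) (Ψ : ideleGroup K →ₜ* (PadicAlgCl ℓ)ˣ)
    (hK : ∀ x ∈ principalIdeles K, Ψ x = 1)
    (hΨ : ∀ᶠ v : HeightOneSpectrum (𝓞 K) in cofinite, ψ.IsUnramifiedAt v ∧
      (∀ u : (v.adicCompletionIntegers K)ˣ,
          Ψ (localUnits v (Units.map ((v.adicCompletionIntegers K).subtype : _ →* _) u)) = 1) ∧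
      ∀ ϖ : (v.adicCompletion K)ˣ, Valued.v (ϖ : v.adicCompletion K) = WithZero.exp (-1 : ℤ) →
        ψ.HasFrobCharpolyAt v
          (Polynomial.X - Polynomial.C ((Ψ (localUnits v ϖ) : (PadicAlgCl ℓ)ˣ) : PadicAlgCl ℓ)))
    (halg : ∀ᶠ v : HeightOneSpectrum (𝓞 K) in cofinite, ψ.IsUnramifiedAt v ∧
      ∀ 𝔓 ∈ v.primesAbove, ∀ σ : absoluteGaloisGroup K, IsArithFrobAt (𝓞 K) σ 𝔓 →
        IsAlgebraic ℚ ((((ψ σ : GL (Fin 1) (PadicAlgCl ℓ)) :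
          Matrix (Fin 1) (Fin 1) (PadicAlgCl ℓ)) 0 0)))
    (L : Finset (HeightOneSpectrum (𝓞 K))) (hL : ∀ v, v ∈ L ↔ (ℓ : 𝓞 K) ∈ v.asIdeal) :
    ∃ N : ℕ, 0 < N ∧ ∃ (n : (K →+* PadicAlgCl ℓ) → ℤ) (m : ℕ), ∀ k : Kˣ,
      (∀ v ∈ L, Valued.v (algebraMap K (v.adicCompletion K) (k : K) - 1) ≤
          WithZero.exp (-(m : ℤ))) →
      (∏ v ∈ L, ((Ψ (localUnits v (globalToLocalUnits v k)) : (PadicAlgCl ℓ)ˣ) : PadicAlgCl ℓ)) ^ N =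
        ∏ τ : K →+* PadicAlgCl ℓ, τ (k : K) ^ (-(n τ)) := by
  classical
  have hp : ℓ.Prime := Fact.out
  set q₀ : ℝ := (ℓ : ℝ)⁻¹ with hq₀def
  have hq0 : 0 < q₀ := inv_pos.mpr (by exact_mod_cast hp.pos)
  have hq1 : q₀ < 1 := inv_lt_one_of_one_lt₀ (by exact_mod_cast hp.one_lt)
  have hqhalf : q₀ ≤ 1 / 2 := by
    rw [hq₀def]
    have : (2 : ℝ) ≤ ℓ := by exact_mod_cast hp.two_le
    rw [inv_le_comm₀ (by positivity) (by norm_num)]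
    simpa using this
  -- ### Step 0: the exceptional set `S` and the algebraic values of `f = ∏_{v∈L} Ψ⟨·⟩_v`
  have hΨ' := hΨ
  have halg' := halg
  rw [Filter.eventually_cofinite] at hΨ' halg'
  set S : Finset (HeightOneSpectrum (𝓞 K)) := L ∪ hΨ'.toFinset ∪ halg'.toFinset with hSdef
  have hgoodΨ : ∀ w ∉ S, ψ.IsUnramifiedAt w ∧
      (∀ u : (w.adicCompletionIntegers K)ˣ,
          Ψ (localUnits w (Units.map ((w.adicCompletionIntegers K).subtype : _ →* _) u)) = 1) ∧
      ∀ ϖ : (w.adicCompletion K)ˣ, Valued.v (ϖ : w.adicCompletion K) = WithZero.exp (-1 : ℤ) →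
        ψ.HasFrobCharpolyAt w (Polynomial.X - Polynomial.C ((Ψ (localUnits w ϖ) :
          (PadicAlgCl ℓ)ˣ) : PadicAlgCl ℓ)) := by
    intro w hw
    by_contra hc
    exact hw (Finset.mem_union_left _ (Finset.mem_union_right _ (hΨ'.mem_toFinset.mpr hc)))
  have hgoodalg : ∀ w ∉ S, ψ.IsUnramifiedAt w ∧
      ∀ 𝔓 ∈ w.primesAbove, ∀ σ : absoluteGaloisGroup K, IsArithFrobAt (𝓞 K) σ 𝔓 →
        IsAlgebraic ℚ ((((ψ σ : GL (Fin 1) (PadicAlgCl ℓ)) :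
          Matrix (Fin 1) (Fin 1) (PadicAlgCl ℓ)) 0 0)) := by
    intro w hw
    by_contra hc
    exact hw (Finset.mem_union_right _ (halg'.mem_toFinset.mpr hc))
  have hS : ∀ w ∉ S, ∀ u : (w.adicCompletionIntegers K)ˣ,
      Ψ (localUnits w (Units.map ((w.adicCompletionIntegers K).subtype : _ →* _) u)) = 1 :=
    fun w hw => (hgoodΨ w hw).2.1
  have halgΨ : ∀ w ∉ S, IsAlgebraic ℚ
      ((Ψ (localUnits w (HeckeCharacter.uniformizer K w)) : (PadicAlgCl ℓ)ˣ) : PadicAlgCl ℓ) := by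
    intro w hw
    obtain ⟨𝔓, h𝔓⟩ := w.primesAbove_nonempty
    obtain ⟨Φ, hΦ⟩ := HeightOneSpectrum.exists_isArithFrobAt_of_mem_primesAbove_holds h𝔓
    have h1 := (FramedGaloisRep.hasFrobCharpolyAt_iff_of_rank_one ψ w _).mp
      ((hgoodΨ w hw).2.2 _ (HeckeCharacter.valued_uniformizer w)) 𝔓 h𝔓 Φ hΦ
    rw [← h1]
    exact (hgoodalg w hw).2 𝔓 h𝔓 Φ hΦ
  have hSfilter : S.filter (fun v => (ℓ : 𝓞 K) ∈ v.asIdeal) = L := by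
    ext v
    simp only [Finset.mem_filter, hSdef, Finset.mem_union]
    constructor
    · rintro ⟨-, hv⟩; exact (hL v).mpr hv
    · intro hv; exact ⟨Or.inl (Or.inl hv), (hL v).mp hv⟩
  have hLS : L ⊆ S := fun v hv => by
    rw [hSdef]; exact Finset.mem_union_left _ (Finset.mem_union_left _ hv)
  set f : Kˣ →* (PadicAlgCl ℓ)ˣ :=
    ∏ v ∈ L, Ψ.toMonoidHom.comp ((localUnits v).comp (globalToLocalUnits (K := K) v)) with hfdef
  have hf : ∀ u : Kˣ, f u = ∏ v ∈ L, Ψ (localUnits v (globalToLocalUnits v u)) := by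
    intro u; rw [hfdef, MonoidHom.finsetProd_apply]; rfl
  have hfval : ∀ u : Kˣ, ((f u : (PadicAlgCl ℓ)ˣ) : PadicAlgCl ℓ) =
      ∏ v ∈ L, ((Ψ (localUnits v (globalToLocalUnits v u)) : (PadicAlgCl ℓ)ˣ) : PadicAlgCl ℓ) := by
    intro u; rw [hf, Units.coe_prod]
  have halgf : ∀ u : Kˣ, (∀ w ∈ S, (ℓ : 𝓞 K) ∉ w.asIdeal → w.valuation K (u : K) = 1) →
      IsAlgebraic ℚ ((f u : (PadicAlgCl ℓ)ˣ) : PadicAlgCl ℓ) := by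
    intro u hu
    have := IdelicCharacter.isAlgebraic_prod_map_localUnits Ψ hK S hS halgΨ u hu
    rwa [hSfilter, ← hf] at this
  -- ### Step 1: the log-linear relation and the level
  obtain ⟨s, hs2, lam, hrel⟩ := exists_logLinear Ψ L (fun v hv => (hL v).mp hv)
  have hqs4 : q₀ ^ s ≤ 1 / 4 := by
    calc q₀ ^ s ≤ q₀ ^ 2 := pow_le_pow_of_le_one hq0.le hq1.le hs2
      _ ≤ (1 / 2) ^ 2 := pow_le_pow_left₀ hq0.le hqhalf 2
      _ = 1 / 4 := by norm_num
  have hqs1 : q₀ ^ s < 1 := hqs4.trans_lt (by norm_num)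
  have hε4 : 4⁻¹ * (ℓ : ℝ)⁻¹ ≤ 1 / 4 := by
    rw [← hq₀def]; nlinarith
  -- the level `m`
  have hM : ∀ v : HeightOneSpectrum (𝓞 K), ∃ M : ℕ, v.valuation K (ℓ : K) = WithZero.exp (-(M : ℤ)) := by
    intro v
    have hne : (ℓ : 𝓞 K) ≠ 0 := by exact_mod_cast hp.ne_zero
    refine ⟨(Associates.mk v.asIdeal).count (Associates.mk (Ideal.span {(ℓ : 𝓞 K)})).factors, ?_⟩
    rw [show (ℓ : K) = algebraMap (𝓞 K) K (ℓ : 𝓞 K) by simp, valuation_of_algebraMap,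
      v.intValuation_if_neg hne]
  choose Mv hMv using hM
  set m : ℕ := s * L.sup Mv with hmdef
  have hlevel : ∀ k : K, (∀ v ∈ L, Valued.v (algebraMap K (v.adicCompletion K) k - 1) ≤
      WithZero.exp (-(m : ℤ))) → ∀ v : HeightOneSpectrum (𝓞 K), (ℓ : 𝓞 K) ∈ v.asIdeal →
      v.valuation K (k - 1) ≤ v.valuation K ((ℓ : K) ^ s) := by
    intro k hk v hv
    have hvL : v ∈ L := (hL v).mpr hv
    have h1 := hk v hvL
    rw [← map_one (algebraMap K (v.adicCompletion K)), ← map_sub, valued_algebraMap_adicCompletion]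
      at h1
    refine h1.trans ?_
    rw [Valuation.map_pow, hMv v, ← WithZero.exp_nsmul, WithZero.exp_le_exp, nsmul_eq_mul]
    have := Finset.le_sup (f := Mv) hvL
    have : (s : ℤ) * (Mv v : ℤ) ≤ (m : ℤ) := by
      rw [hmdef]; push_cast; exact mul_le_mul_of_nonneg_left (by exact_mod_cast this) (by positivity)
    linarith
  -- congruent elements: notation `C k`
  -- basic facts for `k ≡ 1 [ℓ^s]`
  have hCfacts : ∀ k : Kˣ, (∀ v : HeightOneSpectrum (𝓞 K), (ℓ : 𝓞 K) ∈ v.asIdeal →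
      v.valuation K ((k : K) - 1) ≤ v.valuation K ((ℓ : K) ^ s)) →
      (∀ τ : K →+* PadicAlgCl ℓ, ‖1 - τ (k : K)‖ ≤ 1 / 4) ∧
      ‖1 - ((f k : (PadicAlgCl ℓ)ˣ) : PadicAlgCl ℓ)‖ ≤ 1 / 4 ∧
      ((padicLogAlgCl ℓ ((f k : (PadicAlgCl ℓ)ˣ) : PadicAlgCl ℓ) : PadicAlgCl ℓ) : ℂ_[ℓ]) =
        ∑ τ : K →+* PadicAlgCl ℓ, lam τ * ((padicLogAlgCl ℓ (τ (k : K)) : PadicAlgCl ℓ) : ℂ_[ℓ]) := by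
    intro k hk
    obtain ⟨h1, h2, h3⟩ := hrel k hk
    refine ⟨fun τ => (h1 τ).trans (by rw [← hq₀def]; exact hqs4), ?_, ?_⟩
    · rw [hfval]; exact (h2.le).trans hε4
    · rw [hfval]; exact h3
  have hs1 : 1 ≤ s := by omega
  set Γ : Set Kˣ := {k | ∀ v : HeightOneSpectrum (𝓞 K), (ℓ : 𝓞 K) ∈ v.asIdeal →
    v.valuation K ((k : K) - 1) ≤ v.valuation K ((ℓ : K) ^ s)} with hΓdef
  have hΓmem : ∀ k : Kˣ, k ∈ Γ ↔ ∀ v : HeightOneSpectrum (𝓞 K), (ℓ : 𝓞 K) ∈ v.asIdeal →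
      v.valuation K ((k : K) - 1) ≤ v.valuation K ((ℓ : K) ^ s) := fun k => Iff.rfl
  have hΓmul : ∀ k k' : Kˣ, k ∈ Γ → k' ∈ Γ → k * k' ∈ Γ := fun k k' hk hk' => by
    rw [hΓmem, Units.val_mul]; exact Quadratic.cong_mul_sub_one hk hk'
  have hΓzpow : ∀ (k : Kˣ) (e : ℤ), k ∈ Γ → k ^ e ∈ Γ := fun k e hk => by
    rw [hΓmem, Units.val_zpow_eq_zpow_val]; exact cong_zpow_sub_one hs1 hk e
  have hΓprod : ∀ {ι : Type} (t : Finset ι) (k : ι → Kˣ), (∀ i ∈ t, k i ∈ Γ) → ∏ i ∈ t, k i ∈ Γ := by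
    intro ι t k hk
    induction t using Finset.induction_on with
    | empty => rw [Finset.prod_empty, hΓmem]; intro v hv; simp
    | insert a t ha ih =>
      rw [Finset.prod_insert ha]
      exact hΓmul _ _ (hk a (Finset.mem_insert_self a t)) (ih fun i hi => hk i (Finset.mem_insert_of_mem hi))
  -- ### Step 2: coordinates `Fin D ≃ Option Emb`, the vectors `P k`
  set d : ℕ := Fintype.card (K →+* PadicAlgCl ℓ) with hd
  set D : ℕ := d + 1 with hD
  have hcardO : Fintype.card (Option (K →+* PadicAlgCl ℓ)) = D := by rw [Fintype.card_option]
  set ι₀ : Option (K →+* PadicAlgCl ℓ) ≃ Fin D := Fintype.equivFinOfCardEq hcardO with hι₀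
  set ι₁ : (K →+* PadicAlgCl ℓ) ≃ Fin d := Fintype.equivFinOfCardEq rfl with hι₁
  set P : Kˣ → (Fin D → PadicAlgCl ℓ) := fun k i => Option.elim (ι₀.symm i)
    (padicLogAlgCl ℓ ((f k : (PadicAlgCl ℓ)ˣ) : PadicAlgCl ℓ)) (fun τ => padicLogAlgCl ℓ (τ (k : K)))
    with hPdef
  have hPnone : ∀ k, P k (ι₀ none) = padicLogAlgCl ℓ ((f k : (PadicAlgCl ℓ)ˣ) : PadicAlgCl ℓ) := by
    intro k; simp only [hPdef, Equiv.symm_apply_apply, Option.elim]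
  have hPsome : ∀ k τ, P k (ι₀ (some τ)) = padicLogAlgCl ℓ (τ (k : K)) := by
    intro k τ; simp only [hPdef, Equiv.symm_apply_apply, Option.elim]
  have hsumD : ∀ {M : Type} [AddCommMonoid M] (g : Fin D → M),
      ∑ i, g i = g (ι₀ none) + ∑ τ, g (ι₀ (some τ)) := by
    intro M _ g
    rw [← Fintype.sum_equiv ι₀ (fun o => g (ι₀ o)) g (fun o => rfl), Fintype.sum_option]
  have hsumd : ∀ {M : Type} [AddCommMonoid M] (g : Fin d → M),
      ∑ i, g i = ∑ τ, g (ι₁ τ) := by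
    intro M _ g
    rw [← Fintype.sum_equiv ι₁ (fun τ => g (ι₁ τ)) g (fun τ => rfl)]
  -- ### Step 3: the subspace `V` spanned by the `P k`, `k ≡ 1 [ℓ^s]`, is proper
  set V : Submodule (PadicAlgCl ℓ) (Fin D → PadicAlgCl ℓ) := Submodule.span (PadicAlgCl ℓ) (P '' Γ)
    with hVdef
  have hPV : ∀ k ∈ Γ, P k ∈ V := fun k hk => Submodule.subset_span ⟨k, hk, rfl⟩
  set Λ : (Fin D → PadicAlgCl ℓ) → ℂ_[ℓ] := fun y =>
    ((y (ι₀ none) : PadicAlgCl ℓ) : ℂ_[ℓ]) - ∑ τ, lam τ * ((y (ι₀ (some τ)) : PadicAlgCl ℓ) : ℂ_[ℓ])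
    with hΛdef
  have hΛP : ∀ k ∈ Γ, Λ (P k) = 0 := by
    intro k hk
    simp only [hΛdef, hPnone, hPsome]
    rw [(hCfacts k hk).2.2, sub_self]
  have hΛV : ∀ y ∈ V, Λ y = 0 := by
    intro y hy
    refine Submodule.span_induction (p := fun y _ => Λ y = 0) ?_ ?_ ?_ ?_ hy
    · rintro _ ⟨k, hk, rfl⟩; exact hΛP k hk
    · simp [hΛdef]
    · intro x y _ _ hx hy
      have : Λ (x + y) = Λ x + Λ y := by
        simp only [hΛdef, Pi.add_apply, UniformSpace.Completion.coe_add, mul_add, Finset.sum_add_distrib]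
        ring
      rw [this, hx, hy, add_zero]
    · intro c x _ hx
      have : Λ (c • x) = ((c : PadicAlgCl ℓ) : ℂ_[ℓ]) * Λ x := by
        simp only [hΛdef, Pi.smul_apply, smul_eq_mul, UniformSpace.Completion.coe_mul, Finset.mul_sum,
          mul_sub]
        congr 1
        exact Finset.sum_congr rfl fun τ _ => by ring
      rw [this, hx, mul_zero]
  have hVne : V ≠ ⊤ := by
    intro htop
    have h1 : Λ (Pi.single (ι₀ none) 1) = 0 := hΛV _ (htop ▸ Submodule.mem_top)
    have h2 : Λ (Pi.single (ι₀ none) 1) = 1 := by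
      have hne : ∀ τ : K →+* PadicAlgCl ℓ, ι₀ (some τ) ≠ ι₀ none := fun τ h =>
        Option.some_ne_none τ (ι₀.injective h)
      simp only [hΛdef, Pi.single_eq_same, UniformSpace.Completion.coe_one]
      rw [Finset.sum_eq_zero fun τ _ => by rw [Pi.single_eq_of_ne (hne τ)]; simp, sub_zero]
    rw [h2] at h1
    exact one_ne_zero h1
  -- ### Step 4: test elements; the first application of the linear subgroup theorem
  set R : ℕ := D * D + 1 with hRdef
  set T : ℕ := d * d + 1 with hTdef
  obtain ⟨𝔮, π, H, hH, hgood, hinj, hπv, hπc⟩ := exists_test_family (K := K) S L m (T * R)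
  set blk : Fin T × Fin R ≃ Fin (T * R) := finProdFinEquiv with hblk
  have hπΓ : ∀ j, π j ∈ Γ := fun j => hlevel _ (hπc j)
  have hπunit : ∀ j, ∀ w ∈ S, (ℓ : 𝓞 K) ∉ w.asIdeal → w.valuation K ((π j : Kˣ) : K) = 1 := by
    intro j w hw _
    rw [hπv, if_neg]
    rintro rfl
    exact (hgood j).2.2.1 hw
  have hπalg : ∀ j, IsAlgebraic ℚ ((f (π j) : (PadicAlgCl ℓ)ˣ) : PadicAlgCl ℓ) :=
    fun j => halgf _ (hπunit j)
  have halgτ : ∀ (τ : K →+* PadicAlgCl ℓ) (x : K), IsAlgebraic ℚ (τ x) := fun τ x =>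
    (Algebra.IsAlgebraic.isAlgebraic x).algHom τ.toRatAlgHom
  have hPlog : ∀ k ∈ Γ, IsAlgebraic ℚ ((f k : (PadicAlgCl ℓ)ˣ) : PadicAlgCl ℓ) →
      ∀ i, P k i ∈ RoyPadic.logQSpan ℓ := by
    intro k hk hka i
    obtain ⟨o, rfl⟩ := ι₀.surjective i
    cases o with
    | none =>
      rw [hPnone]
      exact Submodule.subset_span ⟨_, hka, (hCfacts k hk).2.1.trans_lt (by norm_num), rfl⟩
    | some τ =>
      rw [hPsome]
      exact Submodule.subset_span ⟨_, halgτ τ _, ((hCfacts k hk).1 τ).trans_lt (by norm_num), rfl⟩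
  obtain ⟨a, ha, hrank⟩ := exists_intRow_of_thm1 (fun j => P (π j))
    (fun j => hPlog _ (hπΓ j) (hπalg j)) V (fun j => hPV _ (hπΓ j)) hVne
  -- ### Step 5: the character `β = f^{a₀} ∏ τ^{a_τ}` and its logarithm
  set a₀ : ℤ := a (ι₀ none) with ha₀def
  set aτ : (K →+* PadicAlgCl ℓ) → ℤ := fun τ => a (ι₀ (some τ)) with haτdef
  set βu : Kˣ →* (PadicAlgCl ℓ)ˣ :=
    { toFun := fun k => f k ^ a₀ * ∏ τ : K →+* PadicAlgCl ℓ, Units.map (τ : K →* PadicAlgCl ℓ) k ^ aτ τ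
      map_one' := by simp
      map_mul' := fun x y => by
        simp only [map_mul, mul_zpow, Finset.prod_mul_distrib]
        exact mul_mul_mul_comm _ _ _ _ } with hβudef
  have hβu : ∀ k, ((βu k : (PadicAlgCl ℓ)ˣ) : PadicAlgCl ℓ) =
      ((f k : (PadicAlgCl ℓ)ˣ) : PadicAlgCl ℓ) ^ a₀ * ∏ τ : K →+* PadicAlgCl ℓ, τ (k : K) ^ aτ τ := by
    intro k
    simp only [hβudef, MonoidHom.coe_mk, OneHom.coe_mk, Units.val_mul, Units.val_zpow_eq_zpow_val,
      Units.coe_prod, Units.coe_map, MonoidHom.coe_coe]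
  set logβ : Kˣ → PadicAlgCl ℓ := fun k => padicLogAlgCl ℓ ((βu k : (PadicAlgCl ℓ)ˣ) : PadicAlgCl ℓ)
    with hlogβdef
  have hlogβ : ∀ k, logβ k = ∑ i, (a i : PadicAlgCl ℓ) * P k i := by
    intro k
    rw [hsumD, hPnone]
    simp only [hPsome]
    rw [hlogβdef]; dsimp only
    rw [hβu, IwasawaLog.log_mul (zpow_ne_zero _ (f k).ne_zero)
      (Finset.prod_ne_zero_iff.mpr fun τ _ => zpow_ne_zero _ ((map_ne_zero τ).mpr k.ne_zero)),
      log_zpow' (f k).ne_zero, log_finset_prod _ _ (fun τ _ => zpow_ne_zero _ ((map_ne_zero τ).mpr k.ne_zero))]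
    congr 1
    exact Finset.sum_congr rfl fun τ _ => log_zpow' ((map_ne_zero τ).mpr k.ne_zero) _
  have hlogβ_mul : ∀ k k', logβ (k * k') = logβ k + logβ k' := by
    intro k k'
    simp only [hlogβdef, map_mul, Units.val_mul]
    exact IwasawaLog.log_mul (Units.ne_zero _) (Units.ne_zero _)
  have hlogβ_zpow : ∀ k (e : ℤ), logβ (k ^ e) = e * logβ k := by
    intro k e
    simp only [hlogβdef, map_zpow, Units.val_zpow_eq_zpow_val]
    exact log_zpow' (Units.ne_zero _) e
  have hlogβ_prod : ∀ {ι : Type} (t : Finset ι) (k : ι → Kˣ), logβ (∏ i ∈ t, k i) = ∑ i ∈ t, logβ (k i) := by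
    intro ι t k
    induction t using Finset.induction_on with
    | empty => simp [hlogβdef, (padicLogAlgCl_isIwasawaLog_holds ℓ).log_one]
    | insert a t ha ih => rw [Finset.prod_insert ha, Finset.sum_insert ha, hlogβ_mul, ih]
  have hβnorm : ∀ k ∈ Γ, ‖1 - ((βu k : (PadicAlgCl ℓ)ˣ) : PadicAlgCl ℓ)‖ ≤ 1 / 4 := by
    intro k hk
    obtain ⟨hτ, hfk, -⟩ := hCfacts k hk
    rw [hβu]
    refine (norm_one_sub_mul_le ((norm_one_sub_zpow_le (hfk.trans_lt (by norm_num)) _).trans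
      (hfk.trans (by norm_num)))).trans (max_le ?_ ?_)
    · exact (norm_one_sub_zpow_le (hfk.trans_lt (by norm_num)) _).trans hfk
    · exact norm_one_sub_prod_le _ _ (by norm_num) (by norm_num) fun τ _ =>
        (norm_one_sub_zpow_le ((hτ τ).trans_lt (by norm_num)) _).trans (hτ τ)
  have hβone : ∀ k ∈ Γ, logβ k = 0 → ((βu k : (PadicAlgCl ℓ)ˣ) : PadicAlgCl ℓ) = 1 :=
    fun k hk h0 => eq_one_of_log_eq_zero (hβnorm k hk) h0
  -- the rank bound for `logβ` on the test elements
  have hrankβ : finrank ℚ (Submodule.span ℚ (Set.range fun j => logβ (π j))) ≤ D * D := by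
    have : (fun j => logβ (π j)) = fun j => ∑ i, (a i : PadicAlgCl ℓ) * P (π j) i := funext fun j => hlogβ _
    rw [this]; exact hrank
  -- ### Step 6: block kernels `κ_t ∈ ker β`
  haveI hfinβ : Module.Finite ℚ ↥(Submodule.span ℚ (Set.range fun j => logβ (π j))) :=
    FiniteDimensional.span_of_finite ℚ (Set.finite_range _)
  have hblock : ∀ t : Fin T, ∃ g : Fin R → ℤ, g ≠ 0 ∧
      ∑ r, (g r : ℚ) • logβ (π (blk (t, r))) = 0 := by
    intro t
    apply exists_int_relation
    have hsub : Submodule.span ℚ (Set.range fun r : Fin R => logβ (π (blk (t, r)))) ≤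
        Submodule.span ℚ (Set.range fun j => logβ (π j)) :=
      Submodule.span_mono (by rintro _ ⟨r, rfl⟩; exact ⟨blk (t, r), rfl⟩)
    calc finrank ℚ ↥(Submodule.span ℚ (Set.range fun r : Fin R => logβ (π (blk (t, r)))))
        ≤ finrank ℚ ↥(Submodule.span ℚ (Set.range fun j => logβ (π j))) := Submodule.finrank_mono hsub
      _ ≤ D * D := hrankβ
      _ < R := Nat.lt_succ_self _
  choose g hg0 hgsum using hblock
  set κ : Fin T → Kˣ := fun t => ∏ r, π (blk (t, r)) ^ g t r with hκdef
  have hκΓ : ∀ t, κ t ∈ Γ := fun t => hΓprod _ _ fun r _ => hΓzpow _ _ (hπΓ _)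
  have hlogκ : ∀ t, logβ (κ t) = 0 := by
    intro t
    rw [hκdef]; dsimp only
    rw [hlogβ_prod]
    simp_rw [hlogβ_zpow]
    have := hgsum t
    simp_rw [Rat.smul_def, Rat.cast_intCast] at this
    exact this
  have hβκ : ∀ t, ((βu (κ t) : (PadicAlgCl ℓ)ˣ) : PadicAlgCl ℓ) = 1 := fun t => hβone _ (hκΓ t) (hlogκ t)
  -- expansion of `β(∏ⱼ πⱼ^{eⱼ})` as a product over `(j, τ)` when `a₀ = 0`-part is split off
  have hβexp : ∀ e : Fin (T * R) → ℤ, ((βu (∏ j, π j ^ e j) : (PadicAlgCl ℓ)ˣ) : PadicAlgCl ℓ) =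
      ((f (∏ j, π j ^ e j) : (PadicAlgCl ℓ)ˣ) : PadicAlgCl ℓ) ^ a₀ *
        ∏ j, ∏ τ : K →+* PadicAlgCl ℓ, τ ((π j : Kˣ) : K) ^ (aτ τ * e j) := by
    intro e
    rw [hβu]
    congr 1
    rw [Finset.prod_comm]
    refine Finset.prod_congr rfl fun τ _ => ?_
    rw [Units.coe_prod, map_prod]
    simp_rw [Units.val_zpow_eq_zpow_val, map_zpow₀]
    rw [← Finset.prod_zpow]
    refine Finset.prod_congr rfl fun j _ => ?_
    rw [← zpow_mul, mul_comm]
  -- `κ_t` as a product over all `j`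
  have hκe : ∀ (G : Fin T → ℤ), ∏ t, κ t ^ G t = ∏ j, π j ^ (G (blk.symm j).1 * g (blk.symm j).1 (blk.symm j).2) := by
    intro G
    rw [← Fintype.prod_equiv blk (fun tr => π (blk tr) ^ (G tr.1 * g tr.1 tr.2)) _ (fun tr => by simp),
      Fintype.prod_prod_type]
    refine Finset.prod_congr rfl fun t _ => ?_
    rw [hκdef]; dsimp only
    rw [← Finset.prod_zpow]
    refine Finset.prod_congr rfl fun r _ => ?_
    rw [← zpow_mul, mul_comm (g t r) (G t)]
  -- ### `a₀ ≠ 0`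
  have hT0 : 0 < T := Nat.succ_pos _
  have ha₀ : a₀ ≠ 0 := by
    intro h0
    have haτ : aτ ≠ 0 := by
      intro hz
      apply ha
      funext i
      obtain ⟨o, rfl⟩ := ι₀.surjective i
      cases o with
      | none => exact h0
      | some τ => exact congrFun hz τ
    -- `β(κ₀) = 1` with `a₀ = 0` is a relation among conjugates only
    set t₀ : Fin T := ⟨0, hT0⟩
    set G : Fin T → ℤ := fun t => if t = t₀ then 1 else 0 with hG
    have hprod : ∏ t, κ t ^ G t = κ t₀ := by
      rw [Finset.prod_eq_single t₀ (fun t _ ht => by rw [hG]; simp [ht]) (fun h => absurd (Finset.mem_univ _) h)]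
      simp [hG]
    have h1 : ((βu (∏ j, π j ^ (G (blk.symm j).1 * g (blk.symm j).1 (blk.symm j).2)) : (PadicAlgCl ℓ)ˣ) :
        PadicAlgCl ℓ) = 1 := by rw [← hκe, hprod]; exact hβκ t₀
    rw [hβexp, h0, zpow_zero, one_mul] at h1
    have hz := eq_zero_of_prod_prod_zpow_eq_one 𝔮 (fun j => (hgood j).1) (fun j => (hgood j).2.1) hinj hH
      (fun j => ((π j : Kˣ) : K)) hπv haτ h1
    apply hg0 t₀
    funext r
    have := congrFun hz (blk (t₀, r))
    simp only [Equiv.symm_apply_apply, hG, if_pos rfl, one_mul, Pi.zero_apply] at this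
    exact this
  -- ### Step 7: the conjugate-logarithm vectors of the `κ_t` span `ℚ̄_ℓ^d`
  set Q : Fin T → (Fin d → PadicAlgCl ℓ) := fun t i => padicLogAlgCl ℓ ((ι₁.symm i) ((κ t : Kˣ) : K))
    with hQdef
  have hQlog : ∀ t i, Q t i ∈ RoyPadic.logQSpan ℓ := by
    intro t i
    exact Submodule.subset_span ⟨_, halgτ _ _,
      ((hCfacts _ (hκΓ t)).1 (ι₁.symm i)).trans_lt (by norm_num), rfl⟩
  have hQtop : Submodule.span (PadicAlgCl ℓ) (Set.range Q) = ⊤ := by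
    by_contra hne
    obtain ⟨a', ha', hrank'⟩ := exists_intRow_of_thm1 Q hQlog (Submodule.span (PadicAlgCl ℓ) (Set.range Q))
      (fun t => Submodule.subset_span ⟨t, rfl⟩) hne
    set a'' : (K →+* PadicAlgCl ℓ) → ℤ := fun τ => a' (ι₁ τ) with ha''
    have ha''ne : a'' ≠ 0 := by
      intro hz; apply ha'; funext i
      have := congrFun hz (ι₁.symm i)
      simpa [ha''] using this
    -- `∑ i a'_i Q_t i = log χ(κ_t)`, `χ = ∏ τ^{a''_τ}`
    set χv : Kˣ → PadicAlgCl ℓ := fun k => ∏ τ : K →+* PadicAlgCl ℓ, τ (k : K) ^ a'' τ with hχv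
    have hχne : ∀ k, χv k ≠ 0 := fun k =>
      Finset.prod_ne_zero_iff.mpr fun τ _ => zpow_ne_zero _ ((map_ne_zero τ).mpr k.ne_zero)
    have hlogχ : ∀ t, ∑ i, (a' i : PadicAlgCl ℓ) * Q t i = padicLogAlgCl ℓ (χv (κ t)) := by
      intro t
      rw [hsumd, hχv]; dsimp only
      rw [log_finset_prod _ _ (fun τ _ => zpow_ne_zero _ ((map_ne_zero τ).mpr (κ t).ne_zero))]
      refine Finset.sum_congr rfl fun τ _ => ?_
      rw [hQdef]; dsimp only
      rw [Equiv.symm_apply_apply, log_zpow' ((map_ne_zero τ).mpr (κ t).ne_zero)]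
    have hχmul : ∀ k k', χv (k * k') = χv k * χv k' := by
      intro k k'; simp only [hχv, Units.val_mul, map_mul, mul_zpow, Finset.prod_mul_distrib]
    have hχzpow : ∀ k (e : ℤ), χv (k ^ e) = χv k ^ e := by
      intro k e
      simp only [hχv, Units.val_zpow_eq_zpow_val, map_zpow₀]
      rw [← Finset.prod_zpow]
      exact Finset.prod_congr rfl fun τ _ => by rw [← zpow_mul, ← zpow_mul, mul_comm]
    have hχprod : ∀ (t : Finset (Fin T)) (k : Fin T → Kˣ), χv (∏ i ∈ t, k i) = ∏ i ∈ t, χv (k i) := by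
      intro t k
      induction t using Finset.induction_on with
      | empty => simp [hχv]
      | insert b t hb ih => rw [Finset.prod_insert hb, Finset.prod_insert hb, hχmul, ih]
    -- an integer relation among the `log χ(κ_t)`
    have hlt : finrank ℚ (Submodule.span ℚ (Set.range fun t => padicLogAlgCl ℓ (χv (κ t)))) < T := by
      have : (fun t => padicLogAlgCl ℓ (χv (κ t))) = fun t => ∑ i, (a' i : PadicAlgCl ℓ) * Q t i :=
        funext fun t => (hlogχ t).symm
      rw [this]
      exact lt_of_le_of_lt hrank' (Nat.lt_succ_self _)
    obtain ⟨G, hG0, hGsum⟩ := exists_int_relation _ hlt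
    simp_rw [Rat.smul_def, Rat.cast_intCast] at hGsum
    -- hence `log χ(∏ κ_t^{G_t}) = 0` and `χ(∏ κ_t^{G_t}) = 1`
    set κG : Kˣ := ∏ t, κ t ^ G t with hκG
    have hκGΓ : κG ∈ Γ := hΓprod _ _ fun t _ => hΓzpow _ _ (hκΓ t)
    have hlog0 : padicLogAlgCl ℓ (χv κG) = 0 := by
      rw [hκG, hχprod]
      simp_rw [hχzpow]
      rw [log_finset_prod _ _ (fun t _ => zpow_ne_zero _ (hχne _))]
      simp_rw [log_zpow' (hχne _)]
      exact hGsum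
    have hnormχ : ‖1 - χv κG‖ ≤ 1 / 4 := by
      obtain ⟨hτ, -, -⟩ := hCfacts κG hκGΓ
      exact norm_one_sub_prod_le _ _ (by norm_num) (by norm_num) fun τ _ =>
        (norm_one_sub_zpow_le ((hτ τ).trans_lt (by norm_num)) _).trans (hτ τ)
    have hχ1 : χv κG = 1 := eq_one_of_log_eq_zero hnormχ hlog0
    -- as a relation among the conjugates of the `π_j`
    have hrel : ∏ j, ∏ τ : K →+* PadicAlgCl ℓ, τ ((π j : Kˣ) : K) ^
        (a'' τ * (G (blk.symm j).1 * g (blk.symm j).1 (blk.symm j).2)) = 1 := by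
      rw [← hχ1, hκG, hκe, hχv]; dsimp only
      rw [Finset.prod_comm]
      refine Finset.prod_congr rfl fun τ _ => ?_
      rw [Units.coe_prod, map_prod]
      simp_rw [Units.val_zpow_eq_zpow_val, map_zpow₀]
      rw [← Finset.prod_zpow]
      refine Finset.prod_congr rfl fun j _ => ?_
      rw [← zpow_mul, mul_comm]
    have hz := eq_zero_of_prod_prod_zpow_eq_one 𝔮 (fun j => (hgood j).1) (fun j => (hgood j).2.1) hinj hH
      (fun j => ((π j : Kˣ) : K)) hπv ha''ne hrel
    obtain ⟨t₁, ht₁⟩ : ∃ t, G t ≠ 0 := by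
      by_contra h; push Not at h; exact hG0 (funext h)
    apply hg0 t₁
    funext r
    have := congrFun hz (blk (t₁, r))
    simp only [Equiv.symm_apply_apply, Pi.zero_apply, mul_eq_zero] at this
    rcases this with h | h
    · exact absurd h ht₁
    · exact h
  -- ### Step 8: `V` is the rational hyperplane `∑ aᵢ yᵢ = 0`
  set Λa : (Fin D → PadicAlgCl ℓ) →ₗ[PadicAlgCl ℓ] PadicAlgCl ℓ :=
    ∑ i, (a i : PadicAlgCl ℓ) • LinearMap.proj i with hΛa
  have hΛa_apply : ∀ y, Λa y = ∑ i, (a i : PadicAlgCl ℓ) * y i := by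
    intro y; simp [hΛa, LinearMap.sum_apply]
  have hPκH : ∀ t, P (κ t) ∈ LinearMap.ker Λa := by
    intro t
    rw [LinearMap.mem_ker, hΛa_apply, ← hlogβ]
    exact hlogκ t
  set W : Submodule (PadicAlgCl ℓ) (Fin D → PadicAlgCl ℓ) :=
    Submodule.span (PadicAlgCl ℓ) (Set.range fun t => P (κ t)) with hWdef
  have hWV : W ≤ V := Submodule.span_le.mpr (by rintro _ ⟨t, rfl⟩; exact hPV _ (hκΓ t))
  have hWH : W ≤ LinearMap.ker Λa := Submodule.span_le.mpr (by rintro _ ⟨t, rfl⟩; exact hPκH t)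
  set pr : (Fin D → PadicAlgCl ℓ) →ₗ[PadicAlgCl ℓ] (Fin d → PadicAlgCl ℓ) :=
    LinearMap.pi fun i => LinearMap.proj (ι₀ (some (ι₁.symm i))) with hpr
  have hprP : ∀ t, pr (P (κ t)) = Q t := by
    intro t; ext i
    simp only [hpr, LinearMap.pi_apply, LinearMap.coe_proj, Function.eval, hPsome, hQdef]
  have hWmap : W.map pr = ⊤ := by
    rw [hWdef, Submodule.map_span, ← Set.range_comp, ← hQtop]
    congr 1
    exact congrArg Set.range (funext fun t => hprP t)
  have hdW : d ≤ finrank (PadicAlgCl ℓ) W := by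
    have := Submodule.finrank_map_le pr W
    rwa [hWmap, finrank_top, Module.finrank_fin_fun] at this
  have hVd : finrank (PadicAlgCl ℓ) V ≤ d := by
    have := Submodule.finrank_lt hVne
    rw [Module.finrank_fin_fun] at this
    omega
  have hWeq : W = V := Submodule.eq_of_le_of_finrank_le hWV (hVd.trans hdW)
  have hVH : V ≤ LinearMap.ker Λa := hWeq ▸ hWH
  have hβΓ : ∀ k ∈ Γ, ((βu k : (PadicAlgCl ℓ)ˣ) : PadicAlgCl ℓ) = 1 := by
    intro k hk
    refine hβone k hk ?_
    rw [hlogβ, ← hΛa_apply]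
    exact LinearMap.mem_ker.mp (hVH (hPV k hk))
  -- ### Step 9: read off the relation `f(k)^{a₀} ∏ τ(k)^{a_τ} = 1`
  have hread : ∀ k : Kˣ, k ∈ Γ →
      ((f k : (PadicAlgCl ℓ)ˣ) : PadicAlgCl ℓ) ^ a₀ = (∏ τ : K →+* PadicAlgCl ℓ, τ (k : K) ^ aτ τ)⁻¹ := by
    intro k hk
    have h1 := hβΓ k hk
    rw [hβu] at h1
    exact eq_inv_of_mul_eq_one_left h1
  rcases lt_or_gt_of_ne ha₀ with hneg | hpos
  · refine ⟨(-a₀).toNat, by omega, fun τ => -aτ τ, m, fun k hk => ?_⟩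
    have hkΓ : k ∈ Γ := hlevel _ hk
    rw [← hfval, ← zpow_natCast, Int.toNat_of_nonneg (by omega), zpow_neg, hread k hkΓ, inv_inv]
    exact Finset.prod_congr rfl fun τ _ => by rw [neg_neg]
  · refine ⟨a₀.toNat, by omega, aτ, m, fun k hk => ?_⟩
    have hkΓ : k ∈ Γ := hlevel _ hk
    rw [← hfval, ← zpow_natCast, Int.toNat_of_nonneg hpos.le, hread k hkΓ, ← Finset.prod_inv_distrib]
    exact Finset.prod_congr rfl fun τ _ => by rw [zpow_neg]

/-! ### The fact -/

/-- **Discharge of `exists_heckeCharacter_of_weaklyDivides` (Böckle–Hui 2025, Theorem 1.1 with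
Cor. 2.10: a weak abelian direct summand of an `E`-rational semisimple `ℓ`-adic representation
comes from an algebraic Hecke character), for every number field `K`.**  The reduction to
Theorem 2.2 is `exists_heckeCharacter_of_weaklyDivides_of_thm22`; Theorem 2.2 is
`LogLinear.pow_isLocallyAlgebraic_of_frobenius_isAlgebraic` above.
[cite: BockleHui2025, Thm 1.1, Thm 2.2, §2.7] -/
theorem _root_.Literature.NumberTheory.GaloisRepresentations.exists_heckeCharacter_of_weaklyDivides_holds :
    exists_heckeCharacter_of_weaklyDivides :=
  exists_heckeCharacter_of_weaklyDivides_of_thm22 fun K _ _ ℓ _ ψ Ψ hK hΨ halg L hL => by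
    classical
    exact pow_isLocallyAlgebraic_of_frobenius_isAlgebraic ψ Ψ hK hΨ halg L hL

end LogLinear

end Literature.NumberTheory.GaloisRepresentations
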